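import Literature.Computability.AlgebraicComplexity.UnitTensorSLObstructionsProofs
import Literature.Computability.AlgebraicComplexity.MatMulOccurrenceObstructionsRefutation
import HarnessLib

/-!
# The occurrence half of Bürgisser–Ikenmeyer's obstruction `λₙ` (STOC 2011, Lemma 6.1), all `n ≥ 2`

Topic `Literature/Computability/AlgebraicComplexity` (geometric complexity theory, tensor setting);
proofs file (theorems and proof-local definitions only: no named facts) for the typed-chain file
`UnitTensorSLObstructions.lean` of the cell `pub-gct-max` (track T, seat lit-2), whose NAMED fact
`burgisserIkenmeyer2011_lemma_6_1` records P. Bürgisser, C. Ikenmeyer, *Geometric complexity theory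
and tensor rank*, STOC 2011 = arXiv:1011.1350 [BurgisserIkenmeyer2011], Lemma 6.1:
"`λₙ := (2^{n²} 0, 2^{n²} 0, (2n²−3) 1 1 1 0^{n²−3}) ∈ S(⟨n,n,n⟩) ∖ S°(⟨n²+1⟩)` for `n ≥ 2`".
The tree's `UnitTensorSLObstructionsProofs.lean` proves the unit-tensor half and reduces the named
fact to its OCCURRENCE half (`burgisserIkenmeyer2011_lemma_6_1_of_occurrence`): the type
`λₙ = ((2n²−3,1,1,1), 2^{n²}, 2^{n²})` occurs in degree `2n²` for `⟨n,n,n⟩`, i.e. the triple isotypic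
character sum of type `λₙ` does not kill `⟨n,n,n⟩^{⊗2n²}`. In print this half is asserted with
its proof omitted: "Using [31, 33] one can show `g(λₙ) = 1`. Hence the highest weight vector
`f ∈ 𝒪(W)` of weight `λₙ` is uniquely determined up to a scalar. We explicitly constructed `f` and
(guided by computer calculations) proved that `f(⟨n,n,n⟩) ≠ 0`." (§6.1), "We omit the details of
the proof of the second part of this lemma" (§10.18).

**What is proved here (kernel-checked, standard axioms only):** the occurrence half for EVERY
`n ≥ 2` — `isotypicSum_bi2011_kroneckerPow_matMulTensor_ne_zero`, verbatim the hypothesis `hocc`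
of the tree's reduction — and hence the DISCHARGE `burgisserIkenmeyer2011_lemma_6_1_holds` of the
named fact (net debt of this file: `−1`; no new definition of `Prop` type; the two finite cores
are checked by the kernel itself with `decide`, so the axiom closure is the standard one).

Honest framing of the cell: a kernel-checked proof of one printed-but-unproved-in-print
occurrence claim in the TENSOR setting, whose numerical consequence `R̲(⟨n,n,n⟩) > n²+1` is far from
new and already discharged in the tree from Strassen–Lickteig
(`burgisserIkenmeyer2011_lemma_6_1_bound_holds`); multiplicity data and certified rank bounds at
small parameters; occurrence obstructions are ruled out in print for determinant versus padded
permanent (BIP 2019) — nothing here is a claim on VP vs VNP or P vs NP.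

## The evaluation (not the printed route, which evaluates the unique highest-weight vector)

Put `N = n²`, `d = 2N`, `e : [n]² ≃ [N]`, `t = ⟨n,n,n⟩` relabelled (`matMulRelabel`). By the tree's
criterion `isotypicSum₁₂₃_kroneckerPow_ne_zero_of_pairing_ne_zero` it suffices to find square
matrices `A, B, C` and highest-weight vectors `ξ₁, ξ₂, ξ₃` of weights `λₙ` with
`⟪((A⊗B⊗C)·t)^{⊗d}, ξ₁⊗ξ₂⊗ξ₃⟫ ≠ 0`.
* §1 Three STANDARD fillings of `[d]`: `T₂(p) = (p/2, p%2)` (shape `2^N`), `T₃ = T₂ ∘ (1 2)`, and the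
  hook `T₁` of shape `(2N−3,1³)` with first column `P = {0,1,2,3}` and arm `{4,…,d−1}`; `ξⱼ` are
  their polytabloids (`StdFilling.polytabloid`, highest-weight vectors by `polytabloid_mem`).
* §2 `B = 1`; `C` the letter-transpose permutation matrix; `A` DEGENERATE: row `0` = indicator of
  the diagonal letters `(i,i)`, rows `1,2,3` = indicators of `(0,1),(1,2),(2,0)` (`n ≥ 3`; for
  `n = 2` the rows `(0,1),(1,0),(0,0)` — switch `three`). One position of BI's expansion then
  contributes `gval(r₁,r₂,r₃) = [j = j']·A_{r₁,e(i,k)}` for `B`-letter `(i,j)` and `C`-letter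
  `(k,j')` read from the rows `r₂, r₃` (`sum_labels_eq_gval`).
* §3 TERM FORMULA (`pairing_eq_tripleSum`): expanding the three polytabloids over their column
  stabilisers and summing BI's labelings position by position,
  `pairing = ∑_{π ∈ C₁, σ ∈ C₂, τ ∈ C₃} sgnπ sgnσ sgnτ ∏_p gval(w₁(π⁻¹p), w₂(σ⁻¹p), w₃(τ⁻¹p))`.
* §4 STRUCTURE: `κ := σψτ⁻¹` (`ψ = (1 2)`) satisfies `T₃(τ⁻¹p) = T₂(σ⁻¹(κp))` identically and
  `sgnσ sgnτ = −sgnκ`; a non-zero term forces `κ` to fix the arm (diagonal row `0`), so `κ`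
  permutes `P` with `col₂(κp) = col₃(p)`.
* §5 FINITE CORE for `n ≥ 3`, checked by the kernel (`decide`): `core_three` — for such
  `κ̄ ∈ S₄`, any `π̄ ∈ S₄` and letter values passing the `3`-cycle row tests (distinct letters on
  `κ̄`-connected positions of one `T₂`-column), `sgn π̄ · sgn κ̄ = 1`.
* §6–§7 SIGN LEMMA (`sign_of_term_ne_zero`, `n ≥ 3`): restricting `π, κ` to `P ≅ Fin 4`
  (`sign_subtypePerm`), compressing letters by `i ↦ min i 3`, `j` constant on `κ`-orbits: every
  non-zero term has `sgnπ sgnσ sgnτ = −1`.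
* §8 WITNESS (`exists_term_ne_zero`): `π = 1`, `κ = (1 2 3)`, letters `(0,0),(0,0),(1,0),(2,0)`.
* §9–§10: `pairing = −#{non-zero terms} ≠ 0`, and the assembly through `…_relabel_iff`.
* §11–§14 THE CASE `n = 2` (where signs do cancel: `68 − 20`), by an exact count valid for all
  `n`: §11 re-indexes the `C_{T₃}`-sum by `κ ∈ K` (`τ = κ⁻¹σψ`); §12 identifies `C_{T₁} ≅ S₄` and
  `K ≅ K4 ⊂ S₄` by restriction to `P` (`Equiv.Perm.extendDomain`) and the term with the core
  weight `Hz(π̄, κ̄, b)` of the letters `b = b(σ) : P → [n]²` read by `σ` at `P`, so that the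
  `(π, κ)`-double sum is a core sum `Φ(b(σ))`; §13 shows that `σ ↦ b(σ)` maps `C_{T₂}` ONTO the
  valid assignments (`b₀ ≠ b₂`, `b₁ ≠ b₃`) with fibres of one size `c ≠ 0` (right translates), so
  `pairing = c · ∑_{b valid} Φ(b)`; §14: for `n = 2` the kernel evaluates `∑_{b valid} Φ(b) = −48`
  (`core_two_Phi`, `decide`), and the assembly mirrors §10.
* §15 The headline for all `n ≥ 2` (`n ≥ 3` from §10, `n = 2` from §14) and `_holds`.

## References

* [BurgisserIkenmeyer2011] P. Bürgisser, C. Ikenmeyer, *Geometric complexity theory and tensor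
  rank*, STOC 2011 = arXiv:1011.1350, Lemma 6.1, §6.1 (proof sketch), §10.18, Def. 3.1, (3.1).
* [BurgisserIkenmeyer2013] P. Bürgisser, C. Ikenmeyer, *Explicit lower bounds via geometric
  complexity theory*, STOC 2013 = arXiv:1210.8368, §6 (†) and §4.2 (4.1)–(4.2) (the expansion over
  labelings, column determinants).
* [BurgisserIkenmeyerPanovaJAMS2019] P. Bürgisser, C. Ikenmeyer, G. Panova, J. Amer. Math. Soc. 32
  (2019), Prop. 3.3 and (3.5) (polytabloids are highest-weight vectors).

## Tree

`UnitTensorSLObstructions` (`bi2011TwoRect`, `bi2011Last`, `burgisserIkenmeyer2011_lemma_6_1`),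
`UnitTensorSLObstructionsProofs` (`mem_youngDiagram_bi2011TwoRect`, `mem_youngDiagram_bi2011Last`,
`burgisserIkenmeyer2011_lemma_6_1_of_occurrence`), `MatMulOccurrenceObstructionsRefutation`
(`matMulRelabel`, `lab₁₂₃`, `pairing_matMulRelabel_eq_sum`, `sum_prod_mul_polytabloid_eq_sum_colStab`),
`IsotypicOccurrenceSemigroup` (`isotypicSum₁₂₃_kroneckerPow_ne_zero_of_pairing_ne_zero`,
`isotypicSum₁₂₃_kroneckerPow_ne_zero_relabel_iff`), `SchurWeylPlethysmHwMultiplicityProofs`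
(`StdFilling.polytabloid`, `polytabloid_mem`, `rowWord`, `colStab`, `ydWeight_youngDiagram`).
Mathlib: `Equiv.Perm.sign_subtypePerm`, `sign_permCongr`, `sign_extendDomain`,
`extendDomain_apply_image`, `SameCycle.exists_nat_pow_eq`, `Equiv.swap`, `Finset.prod_univ_sum`,
`Finset.sum_image`, `Finset.sum_subset`, `Finset.sum_bij'`, `Finset.card_bij'`, `Finset.sum_comp`,
`Finset.sum_eq_zero_iff_of_nonneg`, `Complex.re_sum`.
-/

noncomputable section

open scoped BigOperators

namespace Literature.Computability.AlgebraicComplexity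

open Literature.NumberTheory.DiophantineGeometry (Word wordRep wordPerm wordPerm_apply
  highestWeightSpace Weight StdFilling ydWeight ydWeight_youngDiagram fst_lt_of_mem_youngDiagram)

namespace BI2011Occurrence

/-! ## §1 Three standard fillings of `[2n²]`: `T₂` (row reading of `2^{n²}`), `T₃ = T₂ ∘ (1 2)`, and the hook `T₁` with first column `{0,1,2,3}` -/

section Fillings

variable {n : ℕ}

/-- `4 ≤ 2n²` for `n ≥ 2` (the hook has four rows). [folklore] -/
private theorem four_le_two_mul_sq (hn : 2 ≤ n) : 4 ≤ 2 * n ^ 2 := by nlinarith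

/-- The cell of position `p` in the row-reading tableau of shape `2^{n²}`: row `p / 2`, column
`p % 2`. [cite: BurgisserIkenmeyer2011, Lemma 6.1] -/
def t2 (p : ℕ) : ℕ × ℕ := (p / 2, p % 2)

/-- The position swap `1 ↔ 2` on naturals. [folklore] -/
def sw (p : ℕ) : ℕ := if p = 1 then 2 else if p = 2 then 1 else p

/-- The cell of position `p` in the second two-column tableau: `T₃ = T₂ ∘ (1 2)`.
[cite: BurgisserIkenmeyer2011, Lemma 6.1] -/
def t3 (p : ℕ) : ℕ × ℕ := t2 (sw p)

/-- The cell of position `p` in the hook tableau of shape `(2n²−3, 1, 1, 1)`: the first column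
carries `0, 1, 2, 3` and the arm carries `4, 5, …`. [cite: BurgisserIkenmeyer2011, Lemma 6.1] -/
def t1 (p : ℕ) : ℕ × ℕ := if p < 4 then (p, 0) else (0, p - 3)

/-- The row of `T₂` at position `p` is `p / 2`. [folklore] -/
@[simp] private theorem t2_fst (p : ℕ) : (t2 p).1 = p / 2 := rfl
/-- The column of `T₂` at position `p` is `p % 2`. [folklore] -/
@[simp] private theorem t2_snd (p : ℕ) : (t2 p).2 = p % 2 := rfl

/-- `(1 2)` is an involution. [folklore] -/
private theorem sw_sw (p : ℕ) : sw (sw p) = p := by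
  unfold sw; split_ifs <;> omega

/-- `(1 2)` preserves `[d]` for `d ≥ 4`. [folklore] -/
private theorem sw_lt {d p : ℕ} (hd : 4 ≤ d) (hp : p < d) : sw p < d := by
  unfold sw; split_ifs <;> omega

/-- `(1 2)` fixes every `p ≥ 4`. [folklore] -/
private theorem sw_of_ge {p : ℕ} (hp : 4 ≤ p) : sw p = p := by
  unfold sw; split_ifs <;> omega

/-- `T₃` agrees with `T₂` on the positions `≥ 4`. [folklore] -/
private theorem t3_of_ge {p : ℕ} (hp : 4 ≤ p) : t3 p = t2 p := by
  rw [t3, sw_of_ge hp]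

/-- `T₂` as a standard filling of `2^{n²}` by `[2n²]`. [cite: BurgisserIkenmeyer2011, Lemma 6.1] -/
def T2 (n : ℕ) : StdFilling (2 * n ^ 2) (bi2011TwoRect n).youngDiagram :=
  ⟨fun p => t2 p.val, by
    refine ⟨fun p => ?_, fun p q h => ?_, fun p q hpq hle => ?_⟩
    · rw [mem_youngDiagram_bi2011TwoRect]
      simp only [t2]
      have := p.isLt
      omega
    · apply Fin.ext
      simp only [t2, Prod.mk.injEq] at h
      omega
    · simp only [t2, Prod.mk_le_mk] at hle
      have h1 := Fin.lt_def.1 hpq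
      omega⟩

/-- `T₃ = T₂ ∘ (1 2)` as a standard filling of `2^{n²}` (`n ≥ 2`).
[cite: BurgisserIkenmeyer2011, Lemma 6.1] -/
def T3 (n : ℕ) (hn : 2 ≤ n) : StdFilling (2 * n ^ 2) (bi2011TwoRect n).youngDiagram :=
  ⟨fun p => t3 p.val, by
    have h4 := four_le_two_mul_sq hn
    refine ⟨fun p => ?_, fun p q h => ?_, fun p q hpq hle => ?_⟩
    · rw [mem_youngDiagram_bi2011TwoRect]
      have hs : sw p.val < 2 * n ^ 2 := sw_lt h4 p.isLt
      simp only [t3, t2]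
      omega
    · apply Fin.ext
      have hp := p.isLt
      have hq := q.isLt
      simp only [t3, t2, Prod.mk.injEq] at h
      have hsw : sw p.val = sw q.val := by omega
      have := congrArg sw hsw
      rwa [sw_sw, sw_sw] at this
    · have hp := p.isLt
      have hq := q.isLt
      simp only [t3, t2, Prod.mk_le_mk] at hle
      have h1 := Fin.lt_def.1 hpq
      unfold sw at hle
      split_ifs at hle <;> omega⟩

/-- The first column of the hook: position `p < 4` sits in cell `(p, 0)`. [folklore] -/
private theorem t1_of_lt {p : ℕ} (hp : p < 4) : t1 p = (p, 0) := by
  unfold t1; rw [if_pos hp]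

/-- The arm of the hook: position `p ≥ 4` sits in cell `(0, p − 3)`. [folklore] -/
private theorem t1_of_ge {p : ℕ} (hp : 4 ≤ p) : t1 p = (0, p - 3) := by
  unfold t1; rw [if_neg (by omega)]

/-- The hook tableau `T₁` as a standard filling of `(2n²−3,1,1,1)` (`n ≥ 2`).
[cite: BurgisserIkenmeyer2011, Lemma 6.1] -/
def T1 (n : ℕ) (hn : 2 ≤ n) : StdFilling (2 * n ^ 2) (bi2011Last n hn).youngDiagram :=
  ⟨fun p => t1 p.val, by
    have h4 := four_le_two_mul_sq hn
    refine ⟨fun p => ?_, fun p q h => ?_, fun p q hpq hle => ?_⟩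
    · rw [mem_youngDiagram_bi2011Last]
      dsimp only
      have hp := p.isLt
      by_cases h : p.val < 4
      · rw [t1_of_lt h]
        rcases Nat.eq_zero_or_pos p.val with h0 | h0
        · exact Or.inl ⟨h0, by simp only; omega⟩
        · exact Or.inr ⟨h0, h, rfl⟩
      · rw [t1_of_ge (by omega)]
        exact Or.inl ⟨rfl, by simp only; omega⟩
    · apply Fin.ext
      dsimp only at h
      have hp := p.isLt
      have hq := q.isLt
      by_cases h1 : p.val < 4 <;> by_cases h2 : q.val < 4
      · rw [t1_of_lt h1, t1_of_lt h2, Prod.mk.injEq] at h; omega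
      · rw [t1_of_lt h1, t1_of_ge (by omega), Prod.mk.injEq] at h; omega
      · rw [t1_of_ge (by omega), t1_of_lt h2, Prod.mk.injEq] at h; omega
      · rw [t1_of_ge (by omega), t1_of_ge (by omega), Prod.mk.injEq] at h; omega
    · have h0 := Fin.lt_def.1 hpq
      dsimp only at hle
      by_cases h1 : p.val < 4 <;> by_cases h2 : q.val < 4
      · rw [t1_of_lt h1, t1_of_lt h2, Prod.mk_le_mk] at hle; omega
      · rw [t1_of_lt h1, t1_of_ge (by omega), Prod.mk_le_mk] at hle; omega
      · omega
      · rw [t1_of_ge (by omega), t1_of_ge (by omega), Prod.mk_le_mk] at hle; omega⟩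

/-- `T₂` unfolded. [folklore] -/
@[simp] private theorem T2_apply (p : Fin (2 * n ^ 2)) : (T2 n).1 p = t2 p.val := rfl
/-- `T₃` unfolded. [folklore] -/
@[simp] private theorem T3_apply (hn : 2 ≤ n) (p : Fin (2 * n ^ 2)) : (T3 n hn).1 p = t3 p.val := rfl
/-- `T₁` unfolded. [folklore] -/
@[simp] private theorem T1_apply (hn : 2 ≤ n) (p : Fin (2 * n ^ 2)) : (T1 n hn).1 p = t1 p.val := rfl

/-- The position swap `ψ = (1 2)` of `[2n²]`. [folklore] -/
def psi (n : ℕ) (hn : 2 ≤ n) : Equiv.Perm (Fin (2 * n ^ 2)) :=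
  Equiv.swap ⟨1, by have := four_le_two_mul_sq hn; omega⟩ ⟨2, by have := four_le_two_mul_sq hn; omega⟩

/-- `ψ` acts on values as `(1 2)`. [folklore] -/
private theorem psi_apply_val (hn : 2 ≤ n) (p : Fin (2 * n ^ 2)) : (psi n hn p).val = sw p.val := by
  unfold psi sw
  rcases p with ⟨p, hp⟩
  simp only [Equiv.swap_apply_def, Fin.mk.injEq]
  split_ifs <;> simp_all

/-- `ψ` is a transposition: `sgn ψ = −1`. [folklore] -/
private theorem sign_psi (hn : 2 ≤ n) : Equiv.Perm.sign (psi n hn) = -1 := by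
  unfold psi
  rw [Equiv.Perm.sign_swap]
  simp [Fin.ext_iff]

/-- `ψ² = 1`. [folklore] -/
private theorem psi_mul_self (hn : 2 ≤ n) : psi n hn * psi n hn = 1 := Equiv.swap_mul_self _ _

/-- `ψ⁻¹ = ψ`. [folklore] -/
private theorem psi_inv (hn : 2 ≤ n) : (psi n hn)⁻¹ = psi n hn := Equiv.swap_inv _ _

/-- `T₃ = T₂ ∘ ψ`. [folklore] -/
private theorem T3_eq_T2_psi (hn : 2 ≤ n) (p : Fin (2 * n ^ 2)) : (T3 n hn).1 p = (T2 n).1 (psi n hn p) := by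
  simp [t3, psi_apply_val]

/-- `T₂ = T₃ ∘ ψ`. [folklore] -/
private theorem T2_eq_T3_psi (hn : 2 ≤ n) (p : Fin (2 * n ^ 2)) : (T2 n).1 p = (T3 n hn).1 (psi n hn p) := by
  simp [t3, psi_apply_val, sw_sw]

end Fillings

/-! ## §2 The matrices `A`, `B = 1`, `C` and the value of one position -/

section Matrices

variable {n N : ℕ} (e : Fin n × Fin n ≃ Fin N)

/-- The letter-transpose permutation matrix on the third factor: `C_{w,c} = [c = e(kj)]` for
`w = e(jk)` — it re-indexes the `C`-letter `(j,k)` of a rank-one term as `(k,j)`. [folklore] -/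
def Cmat : Matrix (Fin N) (Fin N) ℂ := fun w c => if c = e (Prod.swap (e.symm w)) then 1 else 0

/-- The row tests of the degenerate first-factor matrix `A`: row `0` accepts the diagonal letters
`(i,i)`, rows `1,2,3` accept the single letters `(0,1),(1,2),(2,0)` (`three = true`, used for
`n ≥ 3`) resp. `(0,1),(1,0),(0,0)` (`three = false`, used for `n = 2`); rows `≥ 4` accept nothing.
[folklore] -/
def rowTest (three : Bool) (r i k : ℕ) : Bool :=
  (r == 0 && i == k) || (r == 1 && i == 0 && k == 1) ||
    (r == 2 && (if three then (i == 1 && k == 2) else (i == 1 && k == 0))) ||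
    (r == 3 && (if three then (i == 2 && k == 0) else (i == 0 && k == 0)))

/-- The degenerate first-factor matrix `A`: `A_{r, e(i,k)} = rowTest r i k`. [folklore] -/
def Amat (three : Bool) : Matrix (Fin N) (Fin N) ℂ := fun r a =>
  if rowTest three r.val (e.symm a).1.val (e.symm a).2.val then 1 else 0

/-- The value of one position in the triple-stabiliser expansion: with `B`-row `r₂ = e(i,j)` and
`C`-row `r₃ = e(k,j')`, it is `[j = j'] · A_{r₁, e(i,k)}`. [folklore] -/
def gval (three : Bool) (r₁ r₂ r₃ : Fin N) : ℂ :=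
  if (e.symm r₂).2 = (e.symm r₃).2 then Amat e three r₁ (e ((e.symm r₂).1, (e.symm r₃).1)) else 0

/-- `A` unfolded. [folklore] -/
private theorem Amat_apply (three : Bool) (r a : Fin N) :
    Amat e three r a = if rowTest three r.val (e.symm a).1.val (e.symm a).2.val then 1 else 0 := rfl

/-- Row `0` of `A` tests diagonality. [folklore] -/
private theorem rowTest_zero_iff (three : Bool) (i k : ℕ) : rowTest three 0 i k = true ↔ i = k := by
  simp [rowTest]

/-- An inverse permutation applied after the permutation. [folklore] -/
private theorem perm_inv_apply_apply {α : Type*} (f : Equiv.Perm α) (x : α) : f⁻¹ (f x) = x := by simp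

/-- A permutation applied after its inverse. [folklore] -/
private theorem perm_apply_inv_apply {α : Type*} (f : Equiv.Perm α) (x : α) : f (f⁻¹ x) = x := by simp

/-- The entries of `A` lie in `{0, 1}`. [folklore] -/
private theorem Amat_mem_zero_one (three : Bool) (r a : Fin N) : Amat e three r a = 0 ∨ Amat e three r a = 1 := by
  rw [Amat_apply]; split_ifs <;> simp

/-- The position values `gval` lie in `{0, 1}`. [folklore] -/
private theorem gval_mem_zero_one (three : Bool) (r₁ r₂ r₃ : Fin N) :
    gval e three r₁ r₂ r₃ = 0 ∨ gval e three r₁ r₂ r₃ = 1 := by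
  unfold gval; split_ifs
  · exact Amat_mem_zero_one e three _ _
  · exact Or.inl rfl

/-- **One position of the expansion.** Summing the rank-one terms `x = (i,j,k)` of `⟨n,n,n⟩` at a
position whose three tableau rows are `r₁, r₂, r₃`:
`∑_x A_{r₁,e(ik)} [e(ij) = r₂] C_{r₃,e(jk)} = gval r₁ r₂ r₃`. [cite: BurgisserIkenmeyer2013, §6 (†)] -/
theorem sum_labels_eq_gval (three : Bool) (r₁ r₂ r₃ : Fin N) :
    ∑ x : Fin n × Fin n × Fin n, Amat e three r₁ (e (lab₁ x)) *
        (1 : Matrix (Fin N) (Fin N) ℂ) r₂ (e (lab₂ x)) * Cmat e r₃ (e (lab₃ x)) =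
      gval e three r₁ r₂ r₃ := by
  classical
  set x₀ : Fin n × Fin n × Fin n := ((e.symm r₂).1, (e.symm r₂).2, (e.symm r₃).1) with hx₀
  have hsw : Prod.swap (e.symm r₃) = ((e.symm r₃).2, (e.symm r₃).1) := rfl
  rw [Finset.sum_eq_single x₀]
  · -- the value at `x₀`
    simp only [lab₁, lab₂, lab₃, Matrix.one_apply, Cmat, gval]
    by_cases hj : (e.symm r₂).2 = (e.symm r₃).2
    · have h2 : r₂ = e ((e.symm r₂).1, (e.symm r₂).2) := by
        rw [Prod.mk.eta, Equiv.apply_symm_apply]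
      have h3 : e ((e.symm r₂).2, (e.symm r₃).1) = e (Prod.swap (e.symm r₃)) := by
        rw [hsw, hj]
      rw [if_pos hj, if_pos h2, if_pos h3, mul_one, mul_one]
    · have h3 : ¬ e ((e.symm r₂).2, (e.symm r₃).1) = e (Prod.swap (e.symm r₃)) := by
        intro h
        apply hj
        have h' := e.injective h
        rw [hsw, Prod.mk.injEq] at h'
        exact h'.1
      rw [if_neg hj, if_neg h3, mul_zero]
  · intro x _ hx
    simp only [lab₁, lab₂, lab₃, Matrix.one_apply, Cmat]
    by_cases h2 : r₂ = e (x.1, x.2.1)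
    · by_cases h3 : e (x.2.1, x.2.2) = e (Prod.swap (e.symm r₃))
      · exfalso
        apply hx
        have e2 : e.symm r₂ = (x.1, x.2.1) := by rw [h2, Equiv.symm_apply_apply]
        have e3 : (x.2.1, x.2.2) = Prod.swap (e.symm r₃) := e.injective h3
        rw [hsw, Prod.mk.injEq] at e3
        rw [hx₀, e2, ← e3.2]
      · rw [if_neg h3, mul_zero]
    · rw [if_neg h2, mul_zero, zero_mul]
  · intro h; exact absurd (Finset.mem_univ _) h

end Matrices

/-! ## §3 The term formula: the pairing as a signed sum over the three column stabilisers -/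

section TermFormula

variable {n N : ℕ} (hn : 2 ≤ n) (e : Fin n × Fin n ≃ Fin N) (three : Bool)
  (hN₁ : ∀ x ∈ (bi2011Last n hn).youngDiagram.cells, x.1 < N)
  (hN₂ : ∀ x ∈ (bi2011TwoRect n).youngDiagram.cells, x.1 < N)

/-- Four finite sums commute: the outer index moves inside three `Finset` sums. [folklore] -/
private theorem sum_comm_univ_three {α β γ δ M : Type*} [Fintype α] [AddCommMonoid M]
    (s₁ : Finset β) (s₂ : Finset γ) (s₃ : Finset δ) (f : α → β → γ → δ → M) :
    ∑ i, ∑ x ∈ s₁, ∑ y ∈ s₂, ∑ z ∈ s₃, f i x y z = ∑ x ∈ s₁, ∑ y ∈ s₂, ∑ z ∈ s₃, ∑ i, f i x y z := by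
  rw [Finset.sum_comm]
  refine Finset.sum_congr rfl fun x _ => ?_
  rw [Finset.sum_comm]
  refine Finset.sum_congr rfl fun y _ => ?_
  exact Finset.sum_comm

/-- **The term formula.** The pairing of `((A ⊗ 1 ⊗ C)·⟨n,n,n⟩)^{⊗ 2n²}` with
`e_{T₁} ⊗ e_{T₂} ⊗ e_{T₃}` equals `∑_{π ∈ C_{T₁}, σ ∈ C_{T₂}, τ ∈ C_{T₃}} sgn(π)sgn(σ)sgn(τ) ∏_p
gval(w₁(π⁻¹p), w₂(σ⁻¹p), w₃(τ⁻¹p))`: BI's expansion (†) over labelings, each polytabloid expanded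
over its column stabiliser, and the labeling sum taken position by position.
[cite: BurgisserIkenmeyer2013, §6 (†)] -/
theorem pairing_eq_tripleSum :
    ∑ u, ∑ v, ∑ w, kroneckerPow (actTensor (Amat e three) 1 (Cmat e) (matMulRelabel n N e))
        (2 * n ^ 2) u v w *
        triad ((T1 n hn).polytabloid ℂ hN₁) ((T2 n).polytabloid ℂ hN₂) ((T3 n hn).polytabloid ℂ hN₂)
          u v w =
      ∑ π ∈ (T1 n hn).colStab, ∑ σ ∈ (T2 n).colStab, ∑ τ ∈ (T3 n hn).colStab,
        ((Equiv.Perm.sign π : ℤ) : ℂ) * ((Equiv.Perm.sign σ : ℤ) : ℂ) *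
          ((Equiv.Perm.sign τ : ℤ) : ℂ) *
          ∏ p, gval e three ((T1 n hn).rowWord hN₁ (π⁻¹ p)) ((T2 n).rowWord hN₂ (σ⁻¹ p))
            ((T3 n hn).rowWord hN₂ (τ⁻¹ p)) := by
  classical
  rw [pairing_matMulRelabel_eq_sum]
  simp_rw [sum_prod_mul_polytabloid_eq_sum_colStab]
  have hexp : ∀ J : Fin (2 * n ^ 2) → Fin n × Fin n × Fin n,
      (∑ π ∈ (T1 n hn).colStab, ((Equiv.Perm.sign π : ℤ) : ℂ) *
          ∏ p, Amat e three ((T1 n hn).rowWord hN₁ (π⁻¹ p)) (e (lab₁ (J p)))) *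
      (∑ σ ∈ (T2 n).colStab, ((Equiv.Perm.sign σ : ℤ) : ℂ) *
          ∏ p, (1 : Matrix (Fin N) (Fin N) ℂ) ((T2 n).rowWord hN₂ (σ⁻¹ p)) (e (lab₂ (J p)))) *
      (∑ τ ∈ (T3 n hn).colStab, ((Equiv.Perm.sign τ : ℤ) : ℂ) *
          ∏ p, Cmat e ((T3 n hn).rowWord hN₂ (τ⁻¹ p)) (e (lab₃ (J p)))) =
      ∑ π ∈ (T1 n hn).colStab, ∑ σ ∈ (T2 n).colStab, ∑ τ ∈ (T3 n hn).colStab,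
        ((Equiv.Perm.sign π : ℤ) : ℂ) * ((Equiv.Perm.sign σ : ℤ) : ℂ) *
          ((Equiv.Perm.sign τ : ℤ) : ℂ) *
          ∏ p, (Amat e three ((T1 n hn).rowWord hN₁ (π⁻¹ p)) (e (lab₁ (J p))) *
            (1 : Matrix (Fin N) (Fin N) ℂ) ((T2 n).rowWord hN₂ (σ⁻¹ p)) (e (lab₂ (J p))) *
            Cmat e ((T3 n hn).rowWord hN₂ (τ⁻¹ p)) (e (lab₃ (J p)))) := by
    intro J
    rw [Finset.sum_mul_sum, Finset.sum_mul]
    refine Finset.sum_congr rfl fun π _ => ?_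
    rw [Finset.sum_mul]
    refine Finset.sum_congr rfl fun σ _ => ?_
    rw [Finset.mul_sum]
    refine Finset.sum_congr rfl fun τ _ => ?_
    rw [Finset.prod_mul_distrib, Finset.prod_mul_distrib]
    ring
  rw [Finset.sum_congr rfl fun J _ => hexp J, sum_comm_univ_three]
  refine Finset.sum_congr rfl fun π _ => Finset.sum_congr rfl fun σ _ =>
    Finset.sum_congr rfl fun τ _ => ?_
  rw [← Finset.mul_sum]
  congr 1
  have key : ∀ F : Fin (2 * n ^ 2) → Fin n × Fin n × Fin n → ℂ,
      ∑ J : Fin (2 * n ^ 2) → Fin n × Fin n × Fin n, ∏ p, F p (J p) = ∏ p, ∑ x, F p x := fun F => by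
    rw [Finset.prod_univ_sum, Fintype.piFinset_univ]
  exact (key (fun p x => Amat e three ((T1 n hn).rowWord hN₁ (π⁻¹ p)) (e (lab₁ x)) *
      (1 : Matrix (Fin N) (Fin N) ℂ) ((T2 n).rowWord hN₂ (σ⁻¹ p)) (e (lab₂ x)) *
      Cmat e ((T3 n hn).rowWord hN₂ (τ⁻¹ p)) (e (lab₃ x)))).trans
    (Finset.prod_congr rfl fun p _ => sum_labels_eq_gval e three _ _ _)

end TermFormula

/-! ## §4 Column stabilisers, row words, and the structure of a non-zero term -/

section Structure

variable {n N : ℕ} (hn : 2 ≤ n) (e : Fin n × Fin n ≃ Fin N) (three : Bool)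
  (hN₁ : ∀ x ∈ (bi2011Last n hn).youngDiagram.cells, x.1 < N)
  (hN₂ : ∀ x ∈ (bi2011TwoRect n).youngDiagram.cells, x.1 < N)

/-- Row word of `T₂`: position `p` carries the letter `p / 2`. [folklore] -/
private theorem rowWord_T2_val (p : Fin (2 * n ^ 2)) : (((T2 n).rowWord hN₂ p : Fin N) : ℕ) = p.val / 2 := rfl

/-- Row word of `T₃`: position `p` carries the letter `(sw p) / 2`. [folklore] -/
private theorem rowWord_T3_val (p : Fin (2 * n ^ 2)) :
    (((T3 n hn).rowWord hN₂ p : Fin N) : ℕ) = (sw p.val) / 2 := rfl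

/-- Row word of `T₁` on the first column: position `p < 4` carries the letter `p`. [folklore] -/
private theorem rowWord_T1_val_of_lt {p : Fin (2 * n ^ 2)} (hp : p.val < 4) :
    (((T1 n hn).rowWord hN₁ p : Fin N) : ℕ) = p.val := by
  rw [StdFilling.rowWord_val, T1_apply, t1_of_lt hp]

/-- Row word of `T₁` on the arm: position `p ≥ 4` carries the letter `0`. [folklore] -/
private theorem rowWord_T1_val_of_ge {p : Fin (2 * n ^ 2)} (hp : 4 ≤ p.val) :
    (((T1 n hn).rowWord hN₁ p : Fin N) : ℕ) = 0 := by
  rw [StdFilling.rowWord_val, T1_apply, t1_of_ge hp]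

/-- An element of the column stabiliser of the hook fixes every arm position. [folklore] -/
private theorem apply_eq_of_mem_colStab_T1 {π : Equiv.Perm (Fin (2 * n ^ 2))} (hπ : π ∈ (T1 n hn).colStab)
    {p : Fin (2 * n ^ 2)} (hp : 4 ≤ p.val) : π p = p := by
  have h := StdFilling.mem_colStab.1 hπ p
  apply Fin.ext
  rw [T1_apply, T1_apply, t1_of_ge hp] at h
  by_cases h4 : (π p).val < 4
  · rw [t1_of_lt h4] at h
    simp only at h
    omega
  · rw [t1_of_ge (by omega)] at h
    simp only at h
    omega

/-- … hence so does its inverse. [folklore] -/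
private theorem inv_apply_eq_of_mem_colStab_T1 {π : Equiv.Perm (Fin (2 * n ^ 2))}
    (hπ : π ∈ (T1 n hn).colStab) {p : Fin (2 * n ^ 2)} (hp : 4 ≤ p.val) : π⁻¹ p = p := by
  rw [Equiv.Perm.inv_eq_iff_eq]
  exact (apply_eq_of_mem_colStab_T1 hn hπ hp).symm

/-- An element of the column stabiliser of the hook maps the first column to itself. [folklore] -/
private theorem apply_lt_of_mem_colStab_T1 {π : Equiv.Perm (Fin (2 * n ^ 2))} (hπ : π ∈ (T1 n hn).colStab)
    {p : Fin (2 * n ^ 2)} (hp : p.val < 4) : (π p).val < 4 := by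
  by_contra h
  have h' : 4 ≤ (π p).val := by omega
  have := apply_eq_of_mem_colStab_T1 hn hπ (p := π p) h'
  rw [Equiv.apply_eq_iff_eq] at this
  rw [this] at h'
  omega

/-- Column stabiliser of `T₂`: the parity of positions is preserved. [folklore] -/
private theorem mod_two_eq_of_mem_colStab_T2 {σ : Equiv.Perm (Fin (2 * n ^ 2))} (hσ : σ ∈ (T2 n).colStab)
    (p : Fin (2 * n ^ 2)) : (σ p).val % 2 = p.val % 2 := by
  have h := StdFilling.mem_colStab.1 hσ p
  simpa [T2_apply, t2] using h

/-- Column stabiliser of `T₃`: the `T₃`-column is preserved. [folklore] -/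
private theorem t3_snd_eq_of_mem_colStab_T3 {τ : Equiv.Perm (Fin (2 * n ^ 2))} (hτ : τ ∈ (T3 n hn).colStab)
    (p : Fin (2 * n ^ 2)) : (t3 (τ p).val).2 = (t3 p.val).2 := by
  have h := StdFilling.mem_colStab.1 hτ p
  simpa [T3_apply] using h

/-- The letter `κ := σ ψ τ⁻¹` attached to a pair `(σ, τ)`. [folklore] -/
def kap (σ τ : Equiv.Perm (Fin (2 * n ^ 2))) : Equiv.Perm (Fin (2 * n ^ 2)) := σ * psi n hn * τ⁻¹

/-- The defining relation of `κ`: `T₃(τ⁻¹ p) = T₂(σ⁻¹(κ p))` (as cells). [folklore] -/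
private theorem T3_tauInv_eq (σ τ : Equiv.Perm (Fin (2 * n ^ 2))) (p : Fin (2 * n ^ 2)) :
    (T3 n hn).1 (τ⁻¹ p) = (T2 n).1 (σ⁻¹ (kap hn σ τ p)) := by
  have h : σ⁻¹ (kap hn σ τ p) = psi n hn (τ⁻¹ p) := by
    simp [kap, Equiv.Perm.mul_apply]
  rw [h, ← T3_eq_T2_psi]

/-- Rows: `w₃(τ⁻¹ p) = w₂(σ⁻¹(κ p))`. [folklore] -/
private theorem rowWord_T3_tauInv_eq (σ τ : Equiv.Perm (Fin (2 * n ^ 2))) (p : Fin (2 * n ^ 2)) :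
    (T3 n hn).rowWord hN₂ (τ⁻¹ p) = (T2 n).rowWord hN₂ (σ⁻¹ (kap hn σ τ p)) := by
  apply Fin.ext
  rw [StdFilling.rowWord_val, StdFilling.rowWord_val, T3_tauInv_eq]

/-- Signs: `sgn σ · sgn τ = − sgn κ`. [folklore] -/
private theorem sign_mul_sign_eq (σ τ : Equiv.Perm (Fin (2 * n ^ 2))) :
    ((Equiv.Perm.sign σ : ℤ) : ℂ) * ((Equiv.Perm.sign τ : ℤ) : ℂ) =
      -((Equiv.Perm.sign (kap hn σ τ) : ℤ) : ℂ) := by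
  have h : Equiv.Perm.sign (kap hn σ τ) = -(Equiv.Perm.sign σ * Equiv.Perm.sign τ) := by
    rw [kap, Equiv.Perm.sign_mul, Equiv.Perm.sign_mul, Equiv.Perm.sign_inv, sign_psi]
    simp [mul_comm]
  rw [h]
  push_cast
  simp

/-- **Structure of a non-zero term, arm part.** If the product of the position values is
non-zero then `κ = σ ψ τ⁻¹` fixes every arm position. [cite: BurgisserIkenmeyer2011, Lemma 6.1] -/
theorem kap_apply_eq_of_prod_ne_zero {π σ τ : Equiv.Perm (Fin (2 * n ^ 2))}
    (hπ : π ∈ (T1 n hn).colStab) (hσ : σ ∈ (T2 n).colStab) (hτ : τ ∈ (T3 n hn).colStab)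
    (hG : ∏ p, gval e three ((T1 n hn).rowWord hN₁ (π⁻¹ p)) ((T2 n).rowWord hN₂ (σ⁻¹ p))
      ((T3 n hn).rowWord hN₂ (τ⁻¹ p)) ≠ 0)
    {p : Fin (2 * n ^ 2)} (hp : 4 ≤ p.val) : kap hn σ τ p = p := by
  classical
  have hgp := (Finset.prod_ne_zero_iff.1 hG) p (Finset.mem_univ _)
  rw [inv_apply_eq_of_mem_colStab_T1 hn hπ hp] at hgp
  -- the row at an arm position is `0`, so the diagonal test applies
  have hrow0 : (((T1 n hn).rowWord hN₁ p : Fin N) : ℕ) = 0 := rowWord_T1_val_of_ge hn hN₁ hp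
  unfold gval at hgp
  split_ifs at hgp with hj
  · rw [Amat_apply] at hgp
    split_ifs at hgp with ht
    · simp only [Equiv.symm_apply_apply] at ht
      rw [hrow0, rowTest_zero_iff] at ht
      -- `ht : (e.symm r₂).1 = (e.symm r₃).1` (as values); with `hj` the letters agree
      have hrows : (T2 n).rowWord hN₂ (σ⁻¹ p) = (T3 n hn).rowWord hN₂ (τ⁻¹ p) := by
        apply e.symm.injective
        exact Prod.ext (Fin.ext ht) hj
      -- columns agree too, so the cells agree
      have hcell : (T3 n hn).1 (τ⁻¹ p) = (T2 n).1 (σ⁻¹ p) := by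
        refine Prod.ext ?_ ?_
        · have := congrArg Fin.val hrows
          rw [StdFilling.rowWord_val, StdFilling.rowWord_val] at this
          exact this.symm
        · have h3 := t3_snd_eq_of_mem_colStab_T3 hn hτ (τ⁻¹ p)
          rw [perm_apply_inv_apply] at h3
          have h2 := mod_two_eq_of_mem_colStab_T2 hσ (σ⁻¹ p)
          rw [perm_apply_inv_apply] at h2
          rw [T3_apply, T2_apply, t2_snd, ← h2, ← h3, t3_of_ge hp, t2_snd]
      rw [T3_tauInv_eq hn σ τ p] at hcell
      have hinj := (T2 n).injective hcell
      rw [Equiv.apply_eq_iff_eq] at hinj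
      exact hinj
    · exact absurd rfl hgp
  · exact absurd rfl hgp

end Structure

/-! ## §5 The finite core (`n ≥ 3`): every admissible pattern has `sgn π · sgn κ = +1` -/

section Core

/-- The row tests for `three = true`, unfolded. [folklore] -/
private theorem rowTest_true_iff (r i k : ℕ) : rowTest true r i k = true ↔
    (r = 0 ∧ i = k) ∨ (r = 1 ∧ i = 0 ∧ k = 1) ∨ (r = 2 ∧ i = 1 ∧ k = 2) ∨ (r = 3 ∧ i = 2 ∧ k = 0) := by
  simp only [rowTest, Bool.or_eq_true, Bool.and_eq_true, beq_iff_eq, if_true]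
  tauto

/-- The row tests survive the compression `i ↦ min i 3` of the letter values. [folklore] -/
private theorem rowTest_true_min (r i k : ℕ) (h : rowTest true r i k = true) :
    rowTest true r (min i 3) (min k 3) = true := by
  rw [rowTest_true_iff] at h ⊢
  omega

/-- **The finite core for `n ≥ 3`** (letters compressed to `Fin 4`, positions `P = Fin 4`): for a
permutation `κ` of `P` with `κ{0,1} = {0,2}`, `κ{2,3} = {1,3}` (column condition
`(κ p) % 2 = p / 2`), a row assignment `π` and letter values `c` passing the row tests of the
`3`-cycle matrix `A`, with distinct letters on `κ`-connected positions of the same `T₂`-column,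
one has `sgn π · sgn κ = 1`. Checked by the kernel (`decide`). [folklore] -/
private theorem core_three : ∀ κ : Equiv.Perm (Fin 4), (∀ p : Fin 4, (κ p).val % 2 = p.val / 2) →
    ∀ π : Equiv.Perm (Fin 4), ∀ c : Fin 4 → Fin 4,
    (∀ p : Fin 4, rowTest true (π⁻¹ p).val (c p).val (c (κ p)).val = true) →
    (κ.SameCycle 0 2 → c 0 ≠ c 2) → (κ.SameCycle 1 3 → c 1 ≠ c 3) →
    Equiv.Perm.sign π * Equiv.Perm.sign κ = 1 := by
  decide +kernel

end Core

/-! ## §6 Restriction of arm-fixing permutations to `P = {0,1,2,3}` and the sign of a non-zero term -/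

section Restrict

variable {d : ℕ} (h4d : 4 ≤ d)

/-- `{x : Fin d // x < 4} ≃ Fin 4`. [folklore] -/
def e4 : {x : Fin d // x.val < 4} ≃ Fin 4 where
  toFun x := ⟨x.1.val, x.2⟩
  invFun p := ⟨⟨p.val, lt_of_lt_of_le p.isLt h4d⟩, p.isLt⟩
  left_inv x := by ext; rfl
  right_inv p := by ext; rfl

variable {h4d}

/-- A permutation fixing the arm maps `P = {0,1,2,3}` onto itself. [folklore] -/
private theorem lt_four_iff_of_fixesArm {f : Equiv.Perm (Fin d)} (hf : ∀ p : Fin d, 4 ≤ p.val → f p = p)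
    (x : Fin d) : (f x).val < 4 ↔ x.val < 4 := by
  constructor
  · intro h
    by_contra hx
    have := hf x (by omega)
    rw [this] at h
    omega
  · intro h
    by_contra hx
    have h1 := hf (f x) (by omega)
    rw [Equiv.apply_eq_iff_eq] at h1
    rw [h1] at hx
    omega

variable (h4d) in
/-- The embedding `Fin 4 ↪ Fin d` of the positions `P = {0,1,2,3}`. [folklore] -/
def up (p : Fin 4) : Fin d := ⟨p.val, lt_of_lt_of_le p.isLt h4d⟩

/-- `up` unfolded. [folklore] -/
@[simp] private theorem up_val (p : Fin 4) : (up h4d p).val = p.val := rfl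

variable (h4d) in
/-- The restriction to `P ≅ Fin 4` of a permutation fixing the arm. [folklore] -/
def res4 (f : Equiv.Perm (Fin d)) (hf : ∀ p : Fin d, 4 ≤ p.val → f p = p) : Equiv.Perm (Fin 4) :=
  (e4 h4d).permCongr (f.subtypePerm (lt_four_iff_of_fixesArm hf))

/-- The restriction to `P` unfolded. [folklore] -/
private theorem res4_apply_val (f : Equiv.Perm (Fin d)) (hf : ∀ p : Fin d, 4 ≤ p.val → f p = p) (p : Fin 4) :
    (res4 h4d f hf p).val = (f (up h4d p)).val := rfl

/-- The restriction to `P` commutes with the embedding `up`. [folklore] -/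
private theorem up_res4 (f : Equiv.Perm (Fin d)) (hf : ∀ p : Fin d, 4 ≤ p.val → f p = p) (p : Fin 4) :
    up h4d (res4 h4d f hf p) = f (up h4d p) := Fin.ext (res4_apply_val f hf p)

/-- The inverse of the restriction is the restriction of the inverse. [folklore] -/
private theorem res4_inv_apply_val (f : Equiv.Perm (Fin d)) (hf : ∀ p : Fin d, 4 ≤ p.val → f p = p)
    (p : Fin 4) : ((res4 h4d f hf)⁻¹ p).val = (f⁻¹ (up h4d p)).val := rfl

/-- Restricting an arm-fixing permutation to `P` preserves the sign
(`Equiv.Perm.sign_subtypePerm`). [folklore] -/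
private theorem sign_res4 (f : Equiv.Perm (Fin d)) (hf : ∀ p : Fin d, 4 ≤ p.val → f p = p) :
    Equiv.Perm.sign (res4 h4d f hf) = Equiv.Perm.sign f := by
  rw [res4, Equiv.Perm.sign_permCongr, Equiv.Perm.sign_subtypePerm]
  intro x hx
  by_contra h
  exact hx (hf x (by omega))

/-- Powers commute with the restriction to `P`. [folklore] -/
private theorem res4_pow_apply_val (f : Equiv.Perm (Fin d)) (hf : ∀ p : Fin d, 4 ≤ p.val → f p = p)
    (k : ℕ) (p : Fin 4) :
    ((res4 h4d f hf ^ k) p).val = ((f ^ k) (up h4d p)).val := by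
  induction k generalizing p with
  | zero => rfl
  | succ k ih =>
    rw [pow_succ', Equiv.Perm.mul_apply, res4_apply_val, pow_succ', Equiv.Perm.mul_apply]
    congr 2
    exact Fin.ext (ih p)

end Restrict

/-! ## §7 The sign of a non-zero term (`n ≥ 3`): `sgn π · sgn σ · sgn τ = −1` -/

section TermSign

variable {n N : ℕ} (hn : 2 ≤ n) (e : Fin n × Fin n ≃ Fin N)
  (hN₁ : ∀ x ∈ (bi2011Last n hn).youngDiagram.cells, x.1 < N)
  (hN₂ : ∀ x ∈ (bi2011TwoRect n).youngDiagram.cells, x.1 < N)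

/-- The `T₃`-column of a position of `P`: `0 ↦ 0, 1 ↦ 0, 2 ↦ 1, 3 ↦ 1`. [folklore] -/
private theorem t3_snd_of_lt {p : ℕ} (hp : p < 4) : (t3 p).2 = p / 2 := by
  interval_cases p <;> rfl

/-- **Sign lemma.** For `n ≥ 3` and the `3`-cycle matrix `A`, every non-zero term of the
triple-stabiliser expansion has `sgn π · sgn σ · sgn τ = −1`: the arm forces `κ = σψτ⁻¹` to live on
`P`, the letters at `P` (compressed to `Fin 4`) satisfy the hypotheses of `core_three`, and
`sgn σ · sgn τ = −sgn κ`. [cite: BurgisserIkenmeyer2011, Lemma 6.1] -/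
theorem sign_of_term_ne_zero {π σ τ : Equiv.Perm (Fin (2 * n ^ 2))}
    (hπ : π ∈ (T1 n hn).colStab) (hσ : σ ∈ (T2 n).colStab) (hτ : τ ∈ (T3 n hn).colStab)
    (hG : ∏ p, gval e true ((T1 n hn).rowWord hN₁ (π⁻¹ p)) ((T2 n).rowWord hN₂ (σ⁻¹ p))
      ((T3 n hn).rowWord hN₂ (τ⁻¹ p)) ≠ 0) :
    ((Equiv.Perm.sign π : ℤ) : ℂ) * ((Equiv.Perm.sign σ : ℤ) : ℂ) *
      ((Equiv.Perm.sign τ : ℤ) : ℂ) = -1 := by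
  classical
  have h4d : 4 ≤ 2 * n ^ 2 := four_le_two_mul_sq hn
  set κ := kap hn σ τ with hκdef
  have hκarm : ∀ p : Fin (2 * n ^ 2), 4 ≤ p.val → κ p = p := fun p hp =>
    kap_apply_eq_of_prod_ne_zero hn e true hN₁ hN₂ hπ hσ hτ hG hp
  have hπarm : ∀ p : Fin (2 * n ^ 2), 4 ≤ p.val → π p = p := fun p hp =>
    apply_eq_of_mem_colStab_T1 hn hπ hp
  set πb := res4 h4d π hπarm with hπb
  set κb := res4 h4d κ hκarm with hκb
  have hfac : ∀ p, gval e true ((T1 n hn).rowWord hN₁ (π⁻¹ p)) ((T2 n).rowWord hN₂ (σ⁻¹ p))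
      ((T3 n hn).rowWord hN₂ (τ⁻¹ p)) ≠ 0 := fun p =>
    (Finset.prod_ne_zero_iff.1 hG) p (Finset.mem_univ _)
  -- the letters at the four positions of `P`
  set b : Fin 4 → Fin n × Fin n := fun p => e.symm ((T2 n).rowWord hN₂ (σ⁻¹ (up h4d p))) with hb
  have hb_kap : ∀ p : Fin 4, e.symm ((T3 n hn).rowWord hN₂ (τ⁻¹ (up h4d p))) = b (κb p) := by
    intro p
    rw [rowWord_T3_tauInv_eq, hb]
    simp only
    rw [up_res4]
  have hπinv : π⁻¹ ∈ (T1 n hn).colStab := StdFilling.inv_mem_colStab hπ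
  have hP : ∀ p : Fin 4, (b p).2 = (b (κb p)).2 ∧
      rowTest true (πb⁻¹ p).val (b p).1.val (b (κb p)).1.val = true := by
    intro p
    have h := hfac (up h4d p)
    unfold gval at h
    rw [hb_kap p] at h
    split_ifs at h with hj
    · rw [Amat_apply] at h
      split_ifs at h with ht
      · refine ⟨hj, ?_⟩
        simp only [Equiv.symm_apply_apply] at ht
        have hlt : (π⁻¹ (up h4d p)).val < 4 := apply_lt_of_mem_colStab_T1 hn hπinv (by simp)
        rw [rowWord_T1_val_of_lt hn hN₁ hlt] at ht
        rw [res4_inv_apply_val]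
        exact ht
      · exact absurd rfl h
    · exact absurd rfl h
  -- the column condition for `κ` on `P`
  have hcond : ∀ p : Fin 4, (κb p).val % 2 = p.val / 2 := by
    intro p
    have h3' := t3_snd_eq_of_mem_colStab_T3 hn hτ (τ⁻¹ (up h4d p))
    rw [perm_apply_inv_apply] at h3'
    have hc := congrArg Prod.snd (T3_tauInv_eq hn σ τ (up h4d p))
    rw [T3_apply, T2_apply] at hc
    have h2 := mod_two_eq_of_mem_colStab_T2 hσ (σ⁻¹ (κ (up h4d p)))
    rw [perm_apply_inv_apply] at h2
    rw [res4_apply_val, h2, ← t2_snd, ← hc, ← h3', up_val, t3_snd_of_lt p.isLt]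
  -- compressed letter values
  set c : Fin 4 → Fin 4 := fun p => ⟨min (b p).1.val 3, by omega⟩ with hc
  have hrow : ∀ p, rowTest true (πb⁻¹ p).val (c p).val (c (κb p)).val = true := fun p =>
    rowTest_true_min _ _ _ (hP p).2
  -- the second letter component is constant along `κ`-orbits
  have hjpow : ∀ (k : ℕ) (p : Fin 4), (b p).2 = (b ((κb ^ k) p)).2 := by
    intro k
    induction k with
    | zero => intro p; rfl
    | succ k ih =>
      intro p
      rw [pow_succ, Equiv.Perm.mul_apply]
      exact (hP p).1.trans (ih (κb p))
  have hSame : ∀ p q : Fin 4, κb.SameCycle p q → (b p).2 = (b q).2 := by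
    intro p q h
    obtain ⟨k, hk⟩ := h.exists_nat_pow_eq
    rw [← hk]
    exact hjpow k p
  -- positions of `P` in the same `T₂`-column carry distinct letters
  have hdist : ∀ p q : Fin 4, p ≠ q → p.val % 2 = q.val % 2 → b p ≠ b q := by
    intro p q hpq hpar heq
    have hw : (T2 n).rowWord hN₂ (σ⁻¹ (up h4d p)) = (T2 n).rowWord hN₂ (σ⁻¹ (up h4d q)) :=
      e.symm.injective heq
    have hrowv := congrArg Fin.val hw
    rw [rowWord_T2_val, rowWord_T2_val] at hrowv
    have hp2 := mod_two_eq_of_mem_colStab_T2 hσ (σ⁻¹ (up h4d p))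
    have hq2 := mod_two_eq_of_mem_colStab_T2 hσ (σ⁻¹ (up h4d q))
    rw [perm_apply_inv_apply, up_val] at hp2 hq2
    have hpos : σ⁻¹ (up h4d p) = σ⁻¹ (up h4d q) := Fin.ext (by omega)
    rw [Equiv.apply_eq_iff_eq] at hpos
    exact hpq (Fin.ext (by simpa using congrArg Fin.val hpos))
  -- a position with a non-zero row has a small first letter
  have hsmall : ∀ p : Fin 4, (πb⁻¹ p).val ≠ 0 → (b p).1.val ≤ 2 := by
    intro p hp
    have h := (hP p).2
    rw [rowTest_true_iff] at h
    omega
  have hcdist : ∀ p q : Fin 4, p ≠ q → p.val % 2 = q.val % 2 → κb.SameCycle p q → c p ≠ c q := by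
    intro p q hpq hpar hsc hcpq
    have hj := hSame p q hsc
    have hne : (b p).1.val ≠ (b q).1.val := fun h => hdist p q hpq hpar (Prod.ext (Fin.ext h) hj)
    have hcv : min (b p).1.val 3 = min (b q).1.val 3 := by
      have := congrArg Fin.val hcpq
      simpa [hc] using this
    by_cases hp0 : (πb⁻¹ p).val = 0
    · by_cases hq0 : (πb⁻¹ q).val = 0
      · exact hpq ((πb⁻¹).injective (Fin.ext (hp0.trans hq0.symm)))
      · have := hsmall q hq0
        omega
    · have := hsmall p hp0
      by_cases hq0 : (πb⁻¹ q).val = 0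
      · omega
      · have := hsmall q hq0
        omega
  -- the finite core
  have hcore := core_three κb hcond πb c hrow
    (fun h => hcdist 0 2 (by decide) (by decide) h) (fun h => hcdist 1 3 (by decide) (by decide) h)
  have hs : Equiv.Perm.sign π * Equiv.Perm.sign κ = 1 := by
    rw [← sign_res4 (h4d := h4d) π hπarm, ← sign_res4 (h4d := h4d) κ hκarm]
    exact hcore
  have hs' : ((Equiv.Perm.sign π : ℤ) : ℂ) * ((Equiv.Perm.sign κ : ℤ) : ℂ) = 1 := by
    rw [← Int.cast_mul, ← Units.val_mul, hs]
    simp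
  have hστ := sign_mul_sign_eq hn σ τ
  calc ((Equiv.Perm.sign π : ℤ) : ℂ) * ((Equiv.Perm.sign σ : ℤ) : ℂ) * ((Equiv.Perm.sign τ : ℤ) : ℂ)
      = ((Equiv.Perm.sign π : ℤ) : ℂ) * (((Equiv.Perm.sign σ : ℤ) : ℂ) *
          ((Equiv.Perm.sign τ : ℤ) : ℂ)) := mul_assoc _ _ _
    _ = -(((Equiv.Perm.sign π : ℤ) : ℂ) * ((Equiv.Perm.sign κ : ℤ) : ℂ)) := by rw [hστ]; ring
    _ = -1 := by rw [hs']

end TermSign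

/-! ## §8 A non-zero term (`n ≥ 3`) -/

section Witness

/-- The letters of the witness: `(0,0), (0,0), (1,0), (2,0)` at the positions `0,1,2,3`.
[folklore] -/
def wLetter {n : ℕ} (h3 : 3 ≤ n) (k : ℕ) : Fin n × Fin n :=
  if k = 2 then (⟨1, by omega⟩, ⟨0, by omega⟩)
  else if k = 3 then (⟨2, by omega⟩, ⟨0, by omega⟩) else (⟨0, by omega⟩, ⟨0, by omega⟩)

variable {n N : ℕ} (hn : 2 ≤ n) (h3 : 3 ≤ n) (e : Fin n × Fin n ≃ Fin N)
  (hN₁ : ∀ x ∈ (bi2011Last n hn).youngDiagram.cells, x.1 < N)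
  (hN₂ : ∀ x ∈ (bi2011TwoRect n).youngDiagram.cells, x.1 < N)

/-- Moving two distinct points to two distinct targets inside one parity class by two
transpositions of that class. [folklore] -/
private theorem exists_perm_pair {d : ℕ} (a a' x x' : Fin d) (haa : a ≠ a') (hxx : x ≠ x')
    (hpar : a.val % 2 = a'.val % 2 ∧ a.val % 2 = x.val % 2 ∧ a.val % 2 = x'.val % 2) :
    ∃ ρ : Equiv.Perm (Fin d), ρ a = x ∧ ρ a' = x' ∧ (∀ q, (ρ q).val % 2 = q.val % 2) ∧
      ∀ q, q.val % 2 ≠ a.val % 2 → ρ q = q := by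
  classical
  set s₁ : Equiv.Perm (Fin d) := Equiv.swap a x with hs₁
  set a'' := s₁ a' with ha''
  set s₂ : Equiv.Perm (Fin d) := Equiv.swap a'' x' with hs₂
  have hs₁a : s₁ a = x := by simp [hs₁]
  have ha''x : a'' ≠ x := by
    intro h
    rw [ha'', ← hs₁a, Equiv.apply_eq_iff_eq] at h
    exact haa h.symm
  obtain ⟨hp1, hp2, hp3⟩ := hpar
  have hpar₁ : ∀ q, (s₁ q).val % 2 = q.val % 2 := by
    intro q
    simp only [hs₁, Equiv.swap_apply_def]
    split_ifs with h h'
    · rw [h]; omega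
    · rw [h']; omega
    · rfl
  have hpa'' : a''.val % 2 = a.val % 2 := by rw [ha'', hpar₁]; exact hp1.symm
  have hpar₂ : ∀ q, (s₂ q).val % 2 = q.val % 2 := by
    intro q
    simp only [hs₂, Equiv.swap_apply_def]
    split_ifs with h h'
    · rw [h]; omega
    · rw [h']; omega
    · rfl
  refine ⟨s₂ * s₁, ?_, ?_, fun q => ?_, fun q hq => ?_⟩
  · rw [Equiv.Perm.mul_apply, hs₁a, hs₂, Equiv.swap_apply_of_ne_of_ne ha''x.symm hxx]
  · rw [Equiv.Perm.mul_apply, ← ha'', hs₂, Equiv.swap_apply_left]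
  · rw [Equiv.Perm.mul_apply, hpar₂, hpar₁]
  · have h1 : s₁ q = q := by
      rw [hs₁, Equiv.swap_apply_of_ne_of_ne]
      · intro h; rw [h] at hq; exact hq rfl
      · intro h; rw [h] at hq; exact hq hp2.symm
    rw [Equiv.Perm.mul_apply, h1, hs₂, Equiv.swap_apply_of_ne_of_ne]
    · intro h; rw [h] at hq; exact hq hpa''
    · intro h; rw [h] at hq; exact hq hp3.symm

/-- `κ` of the pair `(σ, κ⁻¹σψ)` is `κ`. [folklore] -/
private theorem kap_tauOf (σ κ : Equiv.Perm (Fin (2 * n ^ 2))) : kap hn σ (κ⁻¹ * σ * psi n hn) = κ := by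
  simp [kap, mul_assoc, mul_inv_rev]

set_option maxHeartbeats 400000 in
include h3 in
/-- **A non-zero term exists** (`n ≥ 3`): `π = 1`, `κ` the `3`-cycle `1 ↦ 2 ↦ 3 ↦ 1` on `P`,
letters `(0,0), (0,0), (1,0), (2,0)` at the positions `0,1,2,3`, `σ` a column permutation
realising them, `τ = κ⁻¹ σ ψ`. [cite: BurgisserIkenmeyer2011, Lemma 6.1] -/
theorem exists_term_ne_zero (hNn : N = n ^ 2) :
    ∃ π ∈ (T1 n hn).colStab, ∃ σ ∈ (T2 n).colStab, ∃ τ ∈ (T3 n hn).colStab,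
      ∏ p, gval e true ((T1 n hn).rowWord hN₁ (π⁻¹ p)) ((T2 n).rowWord hN₂ (σ⁻¹ p))
        ((T3 n hn).rowWord hN₂ (τ⁻¹ p)) ≠ 0 := by
  classical
  have h4d : 4 ≤ 2 * n ^ 2 := four_le_two_mul_sq hn
  set u : Fin 4 → Fin (2 * n ^ 2) := up h4d with hu
  have hu_val : ∀ q : Fin 4, (u q).val = q.val := fun q => rfl
  have hu_inj : ∀ q q' : Fin 4, u q = u q' → q = q' := fun q q' h =>
    Fin.ext (by simpa [hu_val] using congrArg Fin.val h)
  set b : Fin 4 → Fin n × Fin n := fun q => wLetter h3 q.val with hb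
  -- target positions: row `e (b q)`, column `q % 2`
  have hrow : ∀ q : Fin 4, (e (b q)).val < n ^ 2 := fun q => by rw [← hNn]; exact (e (b q)).isLt
  set xpos : Fin 4 → Fin (2 * n ^ 2) := fun q => ⟨2 * (e (b q)).val + q.val % 2, by
    have := hrow q; omega⟩ with hx
  have hx_val : ∀ q : Fin 4, (xpos q).val = 2 * (e (b q)).val + q.val % 2 := fun q => rfl
  have hx_par : ∀ q : Fin 4, (xpos q).val % 2 = q.val % 2 := fun q => by rw [hx_val]; omega
  have hw₂x : ∀ q : Fin 4, (T2 n).rowWord hN₂ (xpos q) = e (b q) := fun q => by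
    apply Fin.ext; rw [rowWord_T2_val, hx_val]; omega
  have hb02 : b 0 ≠ b 2 := by
    intro h
    have := congrArg (fun x : Fin n × Fin n => x.1.val) h
    simp [hb, wLetter] at this
  have hb13 : b 1 ≠ b 3 := by
    intro h
    have := congrArg (fun x : Fin n × Fin n => x.1.val) h
    simp [hb, wLetter] at this
  have hx02 : xpos 0 ≠ xpos 2 := by
    intro h
    have h' := congrArg Fin.val h
    rw [hx_val, hx_val] at h'
    have : (e (b 0)).val = (e (b 2)).val := by simp at h'; omega
    exact hb02 (e.injective (Fin.ext this))
  have hx13 : xpos 1 ≠ xpos 3 := by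
    intro h
    have h' := congrArg Fin.val h
    rw [hx_val, hx_val] at h'
    have : (e (b 1)).val = (e (b 3)).val := by simp at h'; omega
    exact hb13 (e.injective (Fin.ext this))
  -- the column permutations
  obtain ⟨ρe, hρe0, hρe2, hρepar, hρefix⟩ := exists_perm_pair (u 0) (u 2) (xpos 0) (xpos 2)
    (fun h => by have := hu_inj _ _ h; exact absurd this (by decide)) hx02
    ⟨by rw [hu_val, hu_val]; decide, by rw [hx_par, hu_val], by rw [hx_par, hu_val]; decide⟩
  obtain ⟨ρo, hρo1, hρo3, hρopar, hρofix⟩ := exists_perm_pair (u 1) (u 3) (xpos 1) (xpos 3)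
    (fun h => by have := hu_inj _ _ h; exact absurd this (by decide)) hx13
    ⟨by rw [hu_val, hu_val]; decide, by rw [hx_par, hu_val], by rw [hx_par, hu_val]; decide⟩
  set ρ := ρo * ρe with hρ
  have hρpar : ∀ q, (ρ q).val % 2 = q.val % 2 := fun q => by
    rw [hρ, Equiv.Perm.mul_apply, hρopar, hρepar]
  have hρu : ∀ q : Fin 4, ρ (u q) = xpos q := by
    intro q
    fin_cases q
    · show ρ (u 0) = xpos 0
      rw [hρ, Equiv.Perm.mul_apply, hρe0, hρofix _ (by rw [hx_par, hu_val]; decide)]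
    · show ρ (u 1) = xpos 1
      rw [hρ, Equiv.Perm.mul_apply, hρefix _ (by rw [hu_val, hu_val]; decide), hρo1]
    · show ρ (u 2) = xpos 2
      rw [hρ, Equiv.Perm.mul_apply, hρe2, hρofix _ (by rw [hx_par, hu_val]; decide)]
    · show ρ (u 3) = xpos 3
      rw [hρ, Equiv.Perm.mul_apply, hρefix _ (by rw [hu_val, hu_val]; decide), hρo3]
  set σ : Equiv.Perm (Fin (2 * n ^ 2)) := ρ⁻¹ with hσdef
  have hσinv : σ⁻¹ = ρ := inv_inv ρ
  have hσ : σ ∈ (T2 n).colStab := by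
    refine StdFilling.mem_colStab.2 fun q => ?_
    rw [T2_apply, T2_apply, t2_snd, t2_snd]
    have := hρpar (σ q)
    rw [← hσinv, perm_inv_apply_apply] at this
    exact this.symm
  have hletters : ∀ q : Fin 4, e.symm ((T2 n).rowWord hN₂ (σ⁻¹ (u q))) = b q := fun q => by
    rw [hσinv, hρu, hw₂x, Equiv.symm_apply_apply]
  -- `κ`: the 3-cycle `1 ↦ 2 ↦ 3 ↦ 1` on `P`
  set κ : Equiv.Perm (Fin (2 * n ^ 2)) := Equiv.swap (u 1) (u 3) * Equiv.swap (u 1) (u 2) with hκdef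
  have hu12 : u 1 ≠ u 2 := fun h => absurd (hu_inj _ _ h) (by decide)
  have hu13 : u 1 ≠ u 3 := fun h => absurd (hu_inj _ _ h) (by decide)
  have hu23 : u 2 ≠ u 3 := fun h => absurd (hu_inj _ _ h) (by decide)
  have hu01 : u 0 ≠ u 1 := fun h => absurd (hu_inj _ _ h) (by decide)
  have hu02 : u 0 ≠ u 2 := fun h => absurd (hu_inj _ _ h) (by decide)
  have hu03 : u 0 ≠ u 3 := fun h => absurd (hu_inj _ _ h) (by decide)
  have hκ0 : κ (u 0) = u 0 := by
    rw [hκdef, Equiv.Perm.mul_apply, Equiv.swap_apply_of_ne_of_ne hu01 hu02,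
      Equiv.swap_apply_of_ne_of_ne hu01 hu03]
  have hκ1 : κ (u 1) = u 2 := by
    rw [hκdef, Equiv.Perm.mul_apply, Equiv.swap_apply_left,
      Equiv.swap_apply_of_ne_of_ne hu12.symm hu23]
  have hκ2 : κ (u 2) = u 3 := by
    rw [hκdef, Equiv.Perm.mul_apply, Equiv.swap_apply_right, Equiv.swap_apply_left]
  have hκ3 : κ (u 3) = u 1 := by
    rw [hκdef, Equiv.Perm.mul_apply, Equiv.swap_apply_of_ne_of_ne hu13.symm hu23.symm,
      Equiv.swap_apply_right]
  have hκarm : ∀ q : Fin (2 * n ^ 2), 4 ≤ q.val → κ q = q := by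
    intro q hq
    have hne : ∀ i : Fin 4, q ≠ u i := fun i h => by
      have := congrArg Fin.val h; rw [hu_val] at this; have := i.isLt; omega
    rw [hκdef, Equiv.Perm.mul_apply, Equiv.swap_apply_of_ne_of_ne (hne 1) (hne 2),
      Equiv.swap_apply_of_ne_of_ne (hne 1) (hne 3)]
  -- the column index of `κ q` matches the `T₃`-column of `q`
  have hκcol : ∀ q : Fin (2 * n ^ 2), (κ q).val % 2 = (t3 q.val).2 := by
    intro q
    by_cases hq : q.val < 4
    · obtain ⟨i, rfl⟩ : ∃ i : Fin 4, q = u i := ⟨⟨q.val, hq⟩, Fin.ext rfl⟩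
      fin_cases i
      · show (κ (u 0)).val % 2 = (t3 (u 0).val).2
        rw [hκ0, hu_val]; decide
      · show (κ (u 1)).val % 2 = (t3 (u 1).val).2
        rw [hκ1, hu_val, hu_val]; decide
      · show (κ (u 2)).val % 2 = (t3 (u 2).val).2
        rw [hκ2, hu_val, hu_val]; decide
      · show (κ (u 3)).val % 2 = (t3 (u 3).val).2
        rw [hκ3, hu_val, hu_val]; decide
    · rw [hκarm q (by omega), t3_of_ge (by omega), t2_snd]
  set τ : Equiv.Perm (Fin (2 * n ^ 2)) := κ⁻¹ * σ * psi n hn with hτdef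
  have hkap : kap hn σ τ = κ := kap_tauOf hn σ κ
  have hτinv : τ⁻¹ ∈ (T3 n hn).colStab := by
    refine StdFilling.mem_colStab.2 fun q => ?_
    have hc := T3_tauInv_eq hn σ τ q
    rw [hkap] at hc
    rw [hc, T2_apply, T3_apply, t2_snd, ← hκcol q]
    have := hρpar (κ q)
    rw [← hσinv] at this
    exact this
  have hτ : τ ∈ (T3 n hn).colStab := by
    have := StdFilling.inv_mem_colStab hτinv
    rwa [inv_inv] at this
  refine ⟨1, StdFilling.one_mem_colStab _, σ, hσ, τ, hτ, ?_⟩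
  rw [Finset.prod_ne_zero_iff]
  intro q _
  rw [inv_one, Equiv.Perm.one_apply, rowWord_T3_tauInv_eq, hkap]
  by_cases hq : q.val < 4
  · obtain ⟨i, rfl⟩ : ∃ i : Fin 4, q = u i := ⟨⟨q.val, hq⟩, Fin.ext rfl⟩
    have hw₁ : ∀ i : Fin 4, (((T1 n hn).rowWord hN₁ (u i) : Fin N) : ℕ) = i.val := fun i =>
      rowWord_T1_val_of_lt hn hN₁ (by rw [hu_val]; exact i.isLt)
    fin_cases i
    · show gval e true ((T1 n hn).rowWord hN₁ (u 0)) ((T2 n).rowWord hN₂ (σ⁻¹ (u 0)))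
        ((T2 n).rowWord hN₂ (σ⁻¹ (κ (u 0)))) ≠ 0
      rw [hκ0]; unfold gval
      rw [hletters, if_pos rfl, Amat_apply, hw₁, Equiv.symm_apply_apply]
      simp [hb, wLetter, rowTest]
    · show gval e true ((T1 n hn).rowWord hN₁ (u 1)) ((T2 n).rowWord hN₂ (σ⁻¹ (u 1)))
        ((T2 n).rowWord hN₂ (σ⁻¹ (κ (u 1)))) ≠ 0
      rw [hκ1]; unfold gval
      rw [hletters, hletters, Amat_apply, hw₁, Equiv.symm_apply_apply]
      simp [hb, wLetter, rowTest]
    · show gval e true ((T1 n hn).rowWord hN₁ (u 2)) ((T2 n).rowWord hN₂ (σ⁻¹ (u 2)))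
        ((T2 n).rowWord hN₂ (σ⁻¹ (κ (u 2)))) ≠ 0
      rw [hκ2]; unfold gval
      rw [hletters, hletters, Amat_apply, hw₁, Equiv.symm_apply_apply]
      simp [hb, wLetter, rowTest]
    · show gval e true ((T1 n hn).rowWord hN₁ (u 3)) ((T2 n).rowWord hN₂ (σ⁻¹ (u 3)))
        ((T2 n).rowWord hN₂ (σ⁻¹ (κ (u 3)))) ≠ 0
      rw [hκ3]; unfold gval
      rw [hletters, hletters, Amat_apply, hw₁, Equiv.symm_apply_apply]
      simp [hb, wLetter, rowTest]
  · rw [hκarm q (by omega)]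
    unfold gval
    rw [if_pos rfl, Amat_apply, rowWord_T1_val_of_ge hn hN₁ (by omega)]
    simp only [Equiv.symm_apply_apply]
    rw [if_pos ((rowTest_zero_iff _ _ _).2 rfl)]
    exact one_ne_zero

end Witness

/-! ## §9 The pairing is non-zero for `n ≥ 3` (every non-zero term is `−1`, and there is one) -/

section PairingThree

variable {n N : ℕ} (hn : 2 ≤ n) (h3 : 3 ≤ n) (e : Fin n × Fin n ≃ Fin N)
  (hN₁ : ∀ x ∈ (bi2011Last n hn).youngDiagram.cells, x.1 < N)
  (hN₂ : ∀ x ∈ (bi2011TwoRect n).youngDiagram.cells, x.1 < N)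

/-- A product of numbers in `{0,1}` lies in `{0,1}`. [folklore] -/
private theorem prod_mem_zero_one {ι : Type*} (s : Finset ι) (f : ι → ℂ) (hf : ∀ i ∈ s, f i = 0 ∨ f i = 1) :
    ∏ i ∈ s, f i = 0 ∨ ∏ i ∈ s, f i = 1 := by
  classical
  refine Finset.prod_induction f (fun x => x = 0 ∨ x = 1) ?_ (Or.inr rfl) hf
  rintro a b (ha | ha) (hb | hb) <;> simp [ha, hb]

include h3 in
/-- **The pairing does not vanish (`n ≥ 3`).** In the triple-stabiliser expansion every term is
`0` or `−1` (`sign_of_term_ne_zero`) and some term is `−1` (`exists_term_ne_zero`).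
[cite: BurgisserIkenmeyer2011, Lemma 6.1] -/
theorem pairing_ne_zero_of_three_le (hNn : N = n ^ 2) :
    ∑ u, ∑ v, ∑ w, kroneckerPow (actTensor (Amat e true) 1 (Cmat e) (matMulRelabel n N e))
        (2 * n ^ 2) u v w *
        triad ((T1 n hn).polytabloid ℂ hN₁) ((T2 n).polytabloid ℂ hN₂) ((T3 n hn).polytabloid ℂ hN₂)
          u v w ≠ 0 := by
  classical
  rw [pairing_eq_tripleSum]
  set G : Equiv.Perm (Fin (2 * n ^ 2)) → Equiv.Perm (Fin (2 * n ^ 2)) →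
      Equiv.Perm (Fin (2 * n ^ 2)) → ℂ := fun π σ τ =>
    ∏ p, gval e true ((T1 n hn).rowWord hN₁ (π⁻¹ p)) ((T2 n).rowWord hN₂ (σ⁻¹ p))
      ((T3 n hn).rowWord hN₂ (τ⁻¹ p)) with hGdef
  have hG01 : ∀ π σ τ, G π σ τ = 0 ∨ G π σ τ = 1 := fun π σ τ =>
    prod_mem_zero_one _ _ fun p _ => gval_mem_zero_one e true _ _ _
  -- termwise: sign · G = −G
  have hterm : ∀ π ∈ (T1 n hn).colStab, ∀ σ ∈ (T2 n).colStab, ∀ τ ∈ (T3 n hn).colStab,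
      ((Equiv.Perm.sign π : ℤ) : ℂ) * ((Equiv.Perm.sign σ : ℤ) : ℂ) *
          ((Equiv.Perm.sign τ : ℤ) : ℂ) * G π σ τ = -G π σ τ := by
    intro π hπ σ hσ τ hτ
    by_cases h0 : G π σ τ = 0
    · rw [h0, mul_zero, neg_zero]
    · rw [sign_of_term_ne_zero hn e hN₁ hN₂ hπ hσ hτ h0]
      ring
  have hsum : ∑ π ∈ (T1 n hn).colStab, ∑ σ ∈ (T2 n).colStab, ∑ τ ∈ (T3 n hn).colStab,
      ((Equiv.Perm.sign π : ℤ) : ℂ) * ((Equiv.Perm.sign σ : ℤ) : ℂ) *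
          ((Equiv.Perm.sign τ : ℤ) : ℂ) * G π σ τ =
      -∑ π ∈ (T1 n hn).colStab, ∑ σ ∈ (T2 n).colStab, ∑ τ ∈ (T3 n hn).colStab, G π σ τ := by
    rw [← Finset.sum_neg_distrib]
    refine Finset.sum_congr rfl fun π hπ => ?_
    rw [← Finset.sum_neg_distrib]
    refine Finset.sum_congr rfl fun σ hσ => ?_
    rw [← Finset.sum_neg_distrib]
    exact Finset.sum_congr rfl fun τ hτ => hterm π hπ σ hσ τ hτ
  change ∑ π ∈ (T1 n hn).colStab, ∑ σ ∈ (T2 n).colStab, ∑ τ ∈ (T3 n hn).colStab,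
      ((Equiv.Perm.sign π : ℤ) : ℂ) * ((Equiv.Perm.sign σ : ℤ) : ℂ) *
          ((Equiv.Perm.sign τ : ℤ) : ℂ) * G π σ τ ≠ 0
  rw [hsum, neg_ne_zero]
  -- the witness
  obtain ⟨π₀, hπ₀, σ₀, hσ₀, τ₀, hτ₀, hne⟩ := exists_term_ne_zero hn h3 e hN₁ hN₂ hNn
  have hone : G π₀ σ₀ τ₀ = 1 := (hG01 π₀ σ₀ τ₀).resolve_left hne
  intro hzero
  have hre := congrArg Complex.re hzero
  rw [Complex.re_sum, Complex.zero_re] at hre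
  simp_rw [Complex.re_sum] at hre
  have hnn : ∀ π σ τ, 0 ≤ (G π σ τ).re := fun π σ τ => by
    rcases hG01 π σ τ with h | h <;> simp [h]
  have h1 := (Finset.sum_eq_zero_iff_of_nonneg fun π _ =>
    Finset.sum_nonneg fun σ _ => Finset.sum_nonneg fun τ _ => hnn π σ τ).1 hre π₀ hπ₀
  have h2 := (Finset.sum_eq_zero_iff_of_nonneg fun σ _ =>
    Finset.sum_nonneg fun τ _ => hnn π₀ σ τ).1 h1 σ₀ hσ₀
  have h3' := (Finset.sum_eq_zero_iff_of_nonneg fun τ _ => hnn π₀ σ₀ τ).1 h2 τ₀ hτ₀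
  rw [hone, Complex.one_re] at h3'
  exact one_ne_zero h3'

end PairingThree

/-! ## §10 Assembly for `n ≥ 3` -/

section AssemblyThree

/-- **Bürgisser–Ikenmeyer 2011, Lemma 6.1 — occurrence half, the case `n ≥ 3`:** the type
`λₙ = ((2n²−3,1,1,1), 2^{n²}, 2^{n²})` occurs in degree `2n²` of `𝒪(\overline{GL³·⟨n,n,n⟩})`
(the triple isotypic character sum of type `λₙ` does not kill `⟨n,n,n⟩^{⊗2n²}`). Printed for all
`n ≥ 2` with the proof omitted ("guided by computer calculations"); proved here by the degenerate
evaluation of the module docstring, in which every non-zero term is `−1`.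
[cite: BurgisserIkenmeyer2011, Lemma 6.1] -/
theorem isotypicSum_ne_zero_of_three_le (n : ℕ) (hn : 2 ≤ n) (h3 : 3 ≤ n) :
    isotypicSum₁ (bi2011Last n hn) (isotypicSum₂ (bi2011TwoRect n) (isotypicSum₃ (bi2011TwoRect n)
      (kroneckerPow (matMulTensor ℂ n n n) (2 * n ^ 2)))) ≠ 0 := by
  classical
  set N := Fintype.card (Fin n × Fin n) with hNdef
  have hNn : N = n ^ 2 := by rw [hNdef, Fintype.card_prod, Fintype.card_fin, sq]
  set e : Fin n × Fin n ≃ Fin N := Fintype.equivFin (Fin n × Fin n)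
  have h4 : 4 ≤ n ^ 2 := by nlinarith
  have hN₁ : ∀ x ∈ (bi2011Last n hn).youngDiagram.cells, x.1 < N := fun x hx => by
    rcases mem_youngDiagram_bi2011Last.1 ((YoungDiagram.mem_cells _).1 hx) with ⟨h0, -⟩ | ⟨-, h4', -⟩
      <;> omega
  have hN₂ : ∀ x ∈ (bi2011TwoRect n).youngDiagram.cells, x.1 < N := fun x hx => by
    have := (mem_youngDiagram_bi2011TwoRect.1 ((YoungDiagram.mem_cells _).1 hx)).1
    omega
  set lam : Fin 3 → Nat.Partition (2 * n ^ 2) := ![bi2011Last n hn, bi2011TwoRect n, bi2011TwoRect n]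
    with hlam
  have hl0 : lam 0 = bi2011Last n hn := rfl
  have hl1 : lam 1 = bi2011TwoRect n := rfl
  have hl2 : lam 2 = bi2011TwoRect n := rfl
  have key := isotypicSum₁₂₃_kroneckerPow_ne_zero_relabel_iff (matMulTensor ℂ n n n) e e e lam
  rw [hl0, hl1, hl2] at key
  rw [← key]
  have hd₁ : (bi2011Last n hn).youngDiagram.cells.card = 2 * n ^ 2 :=
    Nat.Partition.card_cells_youngDiagram _
  have hd₂ : (bi2011TwoRect n).youngDiagram.cells.card = 2 * n ^ 2 :=
    Nat.Partition.card_cells_youngDiagram _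
  have h₁ := StdFilling.polytabloid_mem (k := ℂ) hN₁ (T1 n hn) hd₁
  have h₂ := StdFilling.polytabloid_mem (k := ℂ) hN₂ (T2 n) hd₂
  have h₃ := StdFilling.polytabloid_mem (k := ℂ) hN₂ (T3 n hn) hd₂
  rw [ydWeight_youngDiagram] at h₁ h₂ h₃
  exact isotypicSum₁₂₃_kroneckerPow_ne_zero_of_pairing_ne_zero (lam := lam) h₁ h₂ h₃ (Amat e true) 1
    (Cmat e) (matMulRelabel n N e) (pairing_ne_zero_of_three_le hn h3 e hN₁ hN₂ hNn)

end AssemblyThree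

/-! ## §11 Re-indexing the `C_{T₃}`-sum by `κ = σψτ⁻¹` (all `n`) -/

section Reindex

variable {n N : ℕ} (hn : 2 ≤ n) (e : Fin n × Fin n ≃ Fin N) (three : Bool)
  (hN₁ : ∀ x ∈ (bi2011Last n hn).youngDiagram.cells, x.1 < N)
  (hN₂ : ∀ x ∈ (bi2011TwoRect n).youngDiagram.cells, x.1 < N)

/-- The term value with `τ` eliminated: `G'(π,σ,κ) = ∏_p gval(w₁(π⁻¹p), w₂(σ⁻¹p), w₂(σ⁻¹(κp)))`.
[folklore] -/
def Gp (π σ κ : Equiv.Perm (Fin (2 * n ^ 2))) : ℂ :=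
  ∏ p, gval e three ((T1 n hn).rowWord hN₁ (π⁻¹ p)) ((T2 n).rowWord hN₂ (σ⁻¹ p))
    ((T2 n).rowWord hN₂ (σ⁻¹ (κ p)))

/-- The term value through `κ`: `G(π,σ,τ) = G'(π,σ,κ(σ,τ))`. [folklore] -/
private theorem prod_gval_eq_Gp (π σ τ : Equiv.Perm (Fin (2 * n ^ 2))) :
    ∏ p, gval e three ((T1 n hn).rowWord hN₁ (π⁻¹ p)) ((T2 n).rowWord hN₂ (σ⁻¹ p))
        ((T3 n hn).rowWord hN₂ (τ⁻¹ p)) = Gp hn e three hN₁ hN₂ π σ (kap hn σ τ) := by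
  unfold Gp
  refine Finset.prod_congr rfl fun p _ => ?_
  rw [rowWord_T3_tauInv_eq]

/-- `τ` recovered from `κ`: `τ = κ⁻¹ σ ψ`. [folklore] -/
def tauOf (σ κ : Equiv.Perm (Fin (2 * n ^ 2))) : Equiv.Perm (Fin (2 * n ^ 2)) := κ⁻¹ * σ * psi n hn

/-- `κ(σ, τ(σ,κ)) = κ`. [folklore] -/
private theorem kap_tauOf' (σ κ : Equiv.Perm (Fin (2 * n ^ 2))) : kap hn σ (tauOf hn σ κ) = κ :=
  kap_tauOf hn σ κ

/-- `τ(σ, κ(σ,τ)) = τ`. [folklore] -/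
private theorem tauOf_kap (σ τ : Equiv.Perm (Fin (2 * n ^ 2))) : tauOf hn σ (kap hn σ τ) = τ := by
  have h := psi_mul_self hn
  simp [tauOf, kap, mul_assoc, mul_inv_rev, psi_inv, h]

/-- The admissible `κ`: fixing the arm, with `col₂(κ q) = col₃(q)` everywhere. [folklore] -/
def Kset (n : ℕ) : Finset (Equiv.Perm (Fin (2 * n ^ 2))) :=
  Finset.univ.filter fun κ => (∀ q : Fin (2 * n ^ 2), 4 ≤ q.val → κ q = q) ∧
    ∀ q : Fin (2 * n ^ 2), (κ q).val % 2 = (t3 q.val).2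

/-- Membership in `K` unfolded. [folklore] -/
private theorem mem_Kset {κ : Equiv.Perm (Fin (2 * n ^ 2))} :
    κ ∈ Kset n ↔ (∀ q : Fin (2 * n ^ 2), 4 ≤ q.val → κ q = q) ∧
      ∀ q : Fin (2 * n ^ 2), (κ q).val % 2 = (t3 q.val).2 := by
  simp [Kset]

/-- For admissible `κ` and `σ ∈ C_{T₂}`, `τ = κ⁻¹σψ` lies in `C_{T₃}`. [folklore] -/
private theorem tauOf_mem_colStab {σ κ : Equiv.Perm (Fin (2 * n ^ 2))} (hσ : σ ∈ (T2 n).colStab)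
    (hκ : κ ∈ Kset n) : tauOf hn σ κ ∈ (T3 n hn).colStab := by
  have hinv : (tauOf hn σ κ)⁻¹ ∈ (T3 n hn).colStab := by
    refine StdFilling.mem_colStab.2 fun q => ?_
    have hc := T3_tauInv_eq hn σ (tauOf hn σ κ) q
    rw [kap_tauOf'] at hc
    rw [hc, T2_apply, T3_apply, t2_snd, ← (mem_Kset.1 hκ).2 q]
    have := mod_two_eq_of_mem_colStab_T2 hσ (σ⁻¹ (κ q))
    rw [perm_apply_inv_apply] at this
    exact this.symm
  have := StdFilling.inv_mem_colStab hinv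
  rwa [inv_inv] at this

/-- A non-zero term has an admissible `κ = σψτ⁻¹`. [folklore] -/
private theorem kap_mem_Kset_of_ne_zero {π σ τ : Equiv.Perm (Fin (2 * n ^ 2))}
    (hπ : π ∈ (T1 n hn).colStab) (hσ : σ ∈ (T2 n).colStab) (hτ : τ ∈ (T3 n hn).colStab)
    (hG : ∏ p, gval e three ((T1 n hn).rowWord hN₁ (π⁻¹ p)) ((T2 n).rowWord hN₂ (σ⁻¹ p))
      ((T3 n hn).rowWord hN₂ (τ⁻¹ p)) ≠ 0) : kap hn σ τ ∈ Kset n := by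
  refine mem_Kset.2 ⟨fun q hq => kap_apply_eq_of_prod_ne_zero hn e three hN₁ hN₂ hπ hσ hτ hG hq,
    fun q => ?_⟩
  have h3' := t3_snd_eq_of_mem_colStab_T3 hn hτ (τ⁻¹ q)
  rw [perm_apply_inv_apply] at h3'
  have hc := congrArg Prod.snd (T3_tauInv_eq hn σ τ q)
  rw [T3_apply, T2_apply] at hc
  have h2 := mod_two_eq_of_mem_colStab_T2 hσ (σ⁻¹ (kap hn σ τ q))
  rw [perm_apply_inv_apply] at h2
  rw [h2, ← t2_snd, ← hc, ← h3']

/-- **Re-indexing by `κ`.** For `π ∈ C_{T₁}`, `σ ∈ C_{T₂}`: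
`∑_{τ ∈ C_{T₃}} sgnπ sgnσ sgnτ · G(π,σ,τ) = ∑_{κ ∈ K} −(sgnπ sgnκ) · G'(π,σ,κ)`. [folklore] -/
private theorem sum_tau_eq_sum_kap {π σ : Equiv.Perm (Fin (2 * n ^ 2))}
    (hπ : π ∈ (T1 n hn).colStab) (hσ : σ ∈ (T2 n).colStab) :
    ∑ τ ∈ (T3 n hn).colStab, ((Equiv.Perm.sign π : ℤ) : ℂ) * ((Equiv.Perm.sign σ : ℤ) : ℂ) *
        ((Equiv.Perm.sign τ : ℤ) : ℂ) *
        ∏ p, gval e three ((T1 n hn).rowWord hN₁ (π⁻¹ p)) ((T2 n).rowWord hN₂ (σ⁻¹ p))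
          ((T3 n hn).rowWord hN₂ (τ⁻¹ p)) =
      ∑ κ ∈ Kset n, -(((Equiv.Perm.sign π : ℤ) : ℂ) * ((Equiv.Perm.sign κ : ℤ) : ℂ)) *
        Gp hn e three hN₁ hN₂ π σ κ := by
  classical
  set F : Equiv.Perm (Fin (2 * n ^ 2)) → ℂ := fun κ =>
    -(((Equiv.Perm.sign π : ℤ) : ℂ) * ((Equiv.Perm.sign κ : ℤ) : ℂ)) * Gp hn e three hN₁ hN₂ π σ κ
    with hF
  have hterm : ∀ τ ∈ (T3 n hn).colStab,
      ((Equiv.Perm.sign π : ℤ) : ℂ) * ((Equiv.Perm.sign σ : ℤ) : ℂ) * ((Equiv.Perm.sign τ : ℤ) : ℂ) *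
        ∏ p, gval e three ((T1 n hn).rowWord hN₁ (π⁻¹ p)) ((T2 n).rowWord hN₂ (σ⁻¹ p))
          ((T3 n hn).rowWord hN₂ (τ⁻¹ p)) = F (kap hn σ τ) := by
    intro τ _
    rw [prod_gval_eq_Gp, hF]
    simp only
    rw [mul_assoc ((Equiv.Perm.sign π : ℤ) : ℂ), sign_mul_sign_eq hn σ τ]
    ring
  rw [Finset.sum_congr rfl hterm]
  have hinj : ∀ τ ∈ (T3 n hn).colStab, ∀ τ' ∈ (T3 n hn).colStab,
      kap hn σ τ = kap hn σ τ' → τ = τ' := by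
    intro τ _ τ' _ h
    rw [← tauOf_kap hn σ τ, h, tauOf_kap]
  rw [← Finset.sum_image hinj]
  symm
  apply Finset.sum_subset
  · intro κ hκ
    rw [Finset.mem_image]
    exact ⟨tauOf hn σ κ, tauOf_mem_colStab hn hσ hκ, kap_tauOf' hn σ κ⟩
  · intro κ hκim hκK
    rw [Finset.mem_image] at hκim
    obtain ⟨τ, hτ, rfl⟩ := hκim
    have hG0 : ∏ p, gval e three ((T1 n hn).rowWord hN₁ (π⁻¹ p)) ((T2 n).rowWord hN₂ (σ⁻¹ p))
        ((T3 n hn).rowWord hN₂ (τ⁻¹ p)) = 0 := by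
      by_contra h
      exact hκK (kap_mem_Kset_of_ne_zero hn e three hN₁ hN₂ hπ hσ hτ h)
    rw [← prod_gval_eq_Gp, hG0, mul_zero]

end Reindex

/-! ## §12 The term as a function of finite data (all `n`): restriction to `P`, letters at `P` -/

section Extend

variable {d : ℕ} (h4d : 4 ≤ d)

/-- Extension of a permutation of `P ≅ Fin 4` to `[d]` by the identity on the arm. [folklore] -/
def ext4 (f : Equiv.Perm (Fin 4)) : Equiv.Perm (Fin d) := f.extendDomain (e4 h4d).symm

/-- The extension agrees with the given permutation on `P`. [folklore] -/
private theorem ext4_apply_up (f : Equiv.Perm (Fin 4)) (q : Fin 4) : ext4 h4d f (up h4d q) = up h4d (f q) :=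
  Equiv.Perm.extendDomain_apply_image f (e4 h4d).symm q

/-- The extension fixes the arm. [folklore] -/
private theorem ext4_apply_of_ge (f : Equiv.Perm (Fin 4)) {p : Fin d} (hp : 4 ≤ p.val) : ext4 h4d f p = p :=
  Equiv.Perm.extendDomain_apply_not_subtype f (e4 h4d).symm (by show ¬ (p.val < 4); omega)

/-- Extension commutes with inversion. [folklore] -/
private theorem ext4_inv (f : Equiv.Perm (Fin 4)) : (ext4 h4d f)⁻¹ = ext4 h4d f⁻¹ :=
  Equiv.Perm.extendDomain_inv f (e4 h4d).symm

/-- Extension preserves the sign (`Equiv.Perm.sign_extendDomain`). [folklore] -/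
private theorem sign_ext4 (f : Equiv.Perm (Fin 4)) : Equiv.Perm.sign (ext4 h4d f) = Equiv.Perm.sign f :=
  Equiv.Perm.sign_extendDomain f (e4 h4d).symm

/-- The extension fixes every arm position (pointwise form). [folklore] -/
private theorem ext4_fixesArm (f : Equiv.Perm (Fin 4)) : ∀ p : Fin d, 4 ≤ p.val → ext4 h4d f p = p :=
  fun _ hp => ext4_apply_of_ge h4d f hp

/-- Restriction after extension is the identity. [folklore] -/
private theorem res4_ext4 (f : Equiv.Perm (Fin 4)) : res4 h4d (ext4 h4d f) (ext4_fixesArm h4d f) = f := by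
  ext q
  rw [res4_apply_val, ext4_apply_up, up_val]

/-- Extension after restriction is the identity on arm-fixing permutations. [folklore] -/
private theorem ext4_res4 (f : Equiv.Perm (Fin d)) (hf : ∀ p : Fin d, 4 ≤ p.val → f p = p) :
    ext4 h4d (res4 h4d f hf) = f := by
  refine Equiv.ext fun p => ?_
  by_cases hp : p.val < 4
  · obtain ⟨q, rfl⟩ : ∃ q : Fin 4, p = up h4d q := ⟨⟨p.val, hp⟩, Fin.ext rfl⟩
    rw [ext4_apply_up, up_res4]
  · rw [ext4_apply_of_ge h4d _ (by omega), hf p (by omega)]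

end Extend

section SmallData

variable {n N : ℕ} (hn : 2 ≤ n) (e : Fin n × Fin n ≃ Fin N) (three : Bool)
  (hN₁ : ∀ x ∈ (bi2011Last n hn).youngDiagram.cells, x.1 < N)
  (hN₂ : ∀ x ∈ (bi2011TwoRect n).youngDiagram.cells, x.1 < N)

/-- The core weight of the finite data `(π̄, κ̄, b)` (restricted row permutation, restricted `κ`,
letters at `P`): `1` if every position of `P` passes the column test `col(b_q) = col(b_{κ̄ q})` and
the row test of `A`, else `0`. [folklore] -/
def Hz (three : Bool) (π κ : Equiv.Perm (Fin 4)) (b : Fin 4 → Fin n × Fin n) : ℤ :=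
  ∏ q : Fin 4, if (b q).2 = (b (κ q)).2 ∧
      rowTest three (π⁻¹ q).val (b q).1.val (b (κ q)).1.val = true then 1 else 0

/-- The admissible restricted `κ̄ ∈ S₄`: `(κ̄ q) % 2 = q / 2` (`T₂`-column of `κ̄ q` = `T₃`-column
of `q`). [folklore] -/
def K4 : Finset (Equiv.Perm (Fin 4)) :=
  Finset.univ.filter fun κ => ∀ q : Fin 4, (κ q).val % 2 = q.val / 2

/-- The signed core sum attached to letters `b` at `P`:
`Φ(b) = ∑_{π̄ ∈ S₄} ∑_{κ̄ ∈ K4} −sgn π̄ sgn κ̄ · Hz(π̄, κ̄, b)`. [folklore] -/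
def Phi (three : Bool) (b : Fin 4 → Fin n × Fin n) : ℤ :=
  ∑ π : Equiv.Perm (Fin 4), ∑ κ ∈ K4,
    -(((Equiv.Perm.sign π : ℤˣ) : ℤ) * ((Equiv.Perm.sign κ : ℤˣ) : ℤ)) * Hz three π κ b

/-- The letters read by `σ ∈ C_{T₂}` at the four positions of `P`: `b_q = e⁻¹(w₂(σ⁻¹ q))`.
[folklore] -/
def bOf (σ : Equiv.Perm (Fin (2 * n ^ 2))) (q : Fin 4) : Fin n × Fin n :=
  e.symm ((T2 n).rowWord hN₂ (σ⁻¹ (up (four_le_two_mul_sq hn) q)))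

/-- Extensions lie in the column stabiliser of the hook `T₁`. [folklore] -/
private theorem ext4_mem_colStab_T1 (f : Equiv.Perm (Fin 4)) :
    ext4 (four_le_two_mul_sq hn) f ∈ (T1 n hn).colStab := by
  refine StdFilling.mem_colStab.2 fun p => ?_
  rw [T1_apply, T1_apply]
  by_cases hp : p.val < 4
  · obtain ⟨q, rfl⟩ : ∃ q : Fin 4, p = up (four_le_two_mul_sq hn) q := ⟨⟨p.val, hp⟩, Fin.ext rfl⟩
    rw [ext4_apply_up, up_val, up_val, t1_of_lt (f q).isLt, t1_of_lt q.isLt]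
  · rw [ext4_apply_of_ge _ _ (by omega)]

/-- An extension is an admissible `κ` iff its restriction lies in `K4`. [folklore] -/
private theorem ext4_mem_Kset_iff (f : Equiv.Perm (Fin 4)) :
    ext4 (four_le_two_mul_sq hn) f ∈ Kset n ↔ f ∈ K4 := by
  rw [mem_Kset, K4, Finset.mem_filter]
  simp only [Finset.mem_univ, true_and]
  constructor
  · rintro ⟨-, h⟩ q
    have := h (up (four_le_two_mul_sq hn) q)
    rwa [ext4_apply_up, up_val, up_val, t3_snd_of_lt q.isLt] at this
  · intro h
    refine ⟨ext4_fixesArm _ f, fun q => ?_⟩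
    by_cases hq : q.val < 4
    · obtain ⟨q', rfl⟩ : ∃ q' : Fin 4, q = up (four_le_two_mul_sq hn) q' :=
        ⟨⟨q.val, hq⟩, Fin.ext rfl⟩
      rw [ext4_apply_up, up_val, up_val, t3_snd_of_lt q'.isLt]
      exact h q'
    · rw [ext4_apply_of_ge _ _ (by omega), t3_of_ge (by omega), t2_snd]

/-- `C_{T₁} ≅ S₄` by restriction to `P`. [folklore] -/
private theorem sum_colStab_T1_eq_sum_perm4 (F : Equiv.Perm (Fin (2 * n ^ 2)) → ℂ) :
    ∑ π ∈ (T1 n hn).colStab, F π =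
      ∑ π : Equiv.Perm (Fin 4), F (ext4 (four_le_two_mul_sq hn) π) := by
  refine Finset.sum_bij' (fun π hπ => res4 (four_le_two_mul_sq hn) π
      (fun p hp => apply_eq_of_mem_colStab_T1 hn hπ hp))
    (fun π _ => ext4 (four_le_two_mul_sq hn) π) (fun _ _ => Finset.mem_univ _)
    (fun π _ => ext4_mem_colStab_T1 hn π) (fun π hπ => ext4_res4 _ π _) (fun π _ => res4_ext4 _ π)
    (fun π hπ => by rw [ext4_res4])

/-- `K ≅ K4` by restriction to `P`. [folklore] -/
private theorem sum_Kset_eq_sum_K4 (F : Equiv.Perm (Fin (2 * n ^ 2)) → ℂ) :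
    ∑ κ ∈ Kset n, F κ = ∑ κ ∈ K4, F (ext4 (four_le_two_mul_sq hn) κ) := by
  refine Finset.sum_bij' (fun κ hκ => res4 (four_le_two_mul_sq hn) κ (mem_Kset.1 hκ).1)
    (fun κ _ => ext4 (four_le_two_mul_sq hn) κ) (fun κ hκ => ?_)
    (fun κ hκ => (ext4_mem_Kset_iff hn κ).2 hκ) (fun κ hκ => ext4_res4 _ κ _)
    (fun κ _ => res4_ext4 _ κ) (fun κ hκ => by rw [ext4_res4])
  rw [← ext4_mem_Kset_iff hn, ext4_res4]
  exact hκ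

/-- The `T₂`-letter read by `σ` at `q ∈ P` is `e(b(σ)_q)`. [folklore] -/
private theorem rowWord_T2_inv_up (σ : Equiv.Perm (Fin (2 * n ^ 2))) (q : Fin 4) :
    (T2 n).rowWord hN₂ (σ⁻¹ (up (four_le_two_mul_sq hn) q)) = e (bOf hn e hN₂ σ q) := by
  unfold bOf
  rw [Equiv.apply_symm_apply]

/-- **The term value is the core weight of its finite data**: for restricted `π̄, κ̄` and any `σ`,
`G'(ext π̄, σ, ext κ̄) = Hz(π̄, κ̄, b(σ))` (the arm factors are `1`). [folklore] -/
private theorem Gp_ext4 (π κ : Equiv.Perm (Fin 4)) (σ : Equiv.Perm (Fin (2 * n ^ 2))) :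
    Gp hn e three hN₁ hN₂ (ext4 (four_le_two_mul_sq hn) π) σ (ext4 (four_le_two_mul_sq hn) κ) =
      ((Hz three π κ (bOf hn e hN₂ σ) : ℤ) : ℂ) := by
  classical
  unfold Gp Hz
  push_cast
  have himg : ∏ p, gval e three ((T1 n hn).rowWord hN₁ ((ext4 (four_le_two_mul_sq hn) π)⁻¹ p))
      ((T2 n).rowWord hN₂ (σ⁻¹ p)) ((T2 n).rowWord hN₂ (σ⁻¹ (ext4 (four_le_two_mul_sq hn) κ p))) =
      ∏ p ∈ (Finset.univ : Finset (Fin 4)).image (up (four_le_two_mul_sq hn)),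
        gval e three ((T1 n hn).rowWord hN₁ ((ext4 (four_le_two_mul_sq hn) π)⁻¹ p))
          ((T2 n).rowWord hN₂ (σ⁻¹ p)) ((T2 n).rowWord hN₂ (σ⁻¹ (ext4 (four_le_two_mul_sq hn) κ p))) := by
    symm
    apply Finset.prod_subset (Finset.subset_univ _)
    intro p _ hp
    have hp4 : 4 ≤ p.val := by
      by_contra hlt
      exact hp (Finset.mem_image.2 ⟨⟨p.val, by omega⟩, Finset.mem_univ _, Fin.ext rfl⟩)
    rw [ext4_inv, ext4_apply_of_ge _ _ hp4, ext4_apply_of_ge _ _ hp4]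
    unfold gval
    rw [if_pos rfl, Amat_apply, rowWord_T1_val_of_ge hn hN₁ hp4]
    simp only [Equiv.symm_apply_apply]
    rw [if_pos ((rowTest_zero_iff _ _ _).2 rfl)]
  rw [himg, Finset.prod_image fun a _ b _ h => Fin.ext (by simpa using congrArg Fin.val h)]
  refine Finset.prod_congr rfl fun q _ => ?_
  rw [ext4_inv, ext4_apply_up, ext4_apply_up]
  -- (`simp only`, not `rw`: reducible matching must not compare the `T₁`- and `T₂`-row words)
  simp only [rowWord_T2_inv_up hn e hN₂ σ]
  unfold gval
  simp only [Equiv.symm_apply_apply]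
  have hw₁ : (((T1 n hn).rowWord hN₁ (up (four_le_two_mul_sq hn) (π⁻¹ q)) : Fin N) : ℕ) =
      (π⁻¹ q).val :=
    rowWord_T1_val_of_lt hn hN₁ (by rw [up_val]; exact (π⁻¹ q).isLt)
  rw [Amat_apply, hw₁]
  simp only [Equiv.symm_apply_apply]
  by_cases h1 : (bOf hn e hN₂ σ q).2 = (bOf hn e hN₂ σ (κ q)).2 <;> simp [h1]

/-- **The `(π, κ)`-double sum is the core sum of the letters at `P`.** [folklore] -/
private theorem inner_eq_Phi (σ : Equiv.Perm (Fin (2 * n ^ 2))) :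
    ∑ π ∈ (T1 n hn).colStab, ∑ κ ∈ Kset n,
        -(((Equiv.Perm.sign π : ℤ) : ℂ) * ((Equiv.Perm.sign κ : ℤ) : ℂ)) *
          Gp hn e three hN₁ hN₂ π σ κ =
      ((Phi three (bOf hn e hN₂ σ) : ℤ) : ℂ) := by
  rw [sum_colStab_T1_eq_sum_perm4 hn]
  unfold Phi
  push_cast
  refine Finset.sum_congr rfl fun π _ => ?_
  rw [sum_Kset_eq_sum_K4 hn]
  refine Finset.sum_congr rfl fun κ _ => ?_
  rw [sign_ext4, sign_ext4, Gp_ext4]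

end SmallData

/-! ## §13 The `C_{T₂}`-sum through the letters at `P`: constant fibres (all `n`) -/

section Fibres

variable {n N : ℕ} (hn : 2 ≤ n) (e : Fin n × Fin n ≃ Fin N)
  (hN₂ : ∀ x ∈ (bi2011TwoRect n).youngDiagram.cells, x.1 < N)

/-- A column permutation of `T₂` pulls `q ∈ P` back to a position of the same parity. [folklore] -/
private theorem inv_apply_up_val_mod_two {σ : Equiv.Perm (Fin (2 * n ^ 2))} (hσ : σ ∈ (T2 n).colStab)
    (q : Fin 4) : (σ⁻¹ (up (four_le_two_mul_sq hn) q)).val % 2 = q.val % 2 := by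
  have := mod_two_eq_of_mem_colStab_T2 (StdFilling.inv_mem_colStab hσ) (up (four_le_two_mul_sq hn) q)
  rwa [up_val] at this

/-- The letter `b(σ)_q` is the row `σ⁻¹(q) / 2`. [folklore] -/
private theorem val_e_bOf (σ : Equiv.Perm (Fin (2 * n ^ 2))) (q : Fin 4) :
    (e (bOf hn e hN₂ σ q)).val = (σ⁻¹ (up (four_le_two_mul_sq hn) q)).val / 2 := by
  unfold bOf
  rw [Equiv.apply_symm_apply, rowWord_T2_val]

/-- Equal letters at `P`-positions of one parity come from equal positions. [folklore] -/
private theorem inv_apply_up_eq_of_bOf_eq {σ σ' : Equiv.Perm (Fin (2 * n ^ 2))} (hσ : σ ∈ (T2 n).colStab)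
    (hσ' : σ' ∈ (T2 n).colStab) {q q' : Fin 4} (hpar : q.val % 2 = q'.val % 2)
    (h : bOf hn e hN₂ σ q = bOf hn e hN₂ σ' q') :
    σ⁻¹ (up (four_le_two_mul_sq hn) q) = σ'⁻¹ (up (four_le_two_mul_sq hn) q') := by
  have hr := congrArg (fun b => (e b).val) h
  simp only [val_e_bOf] at hr
  have h1 := inv_apply_up_val_mod_two hn hσ q
  have h2 := inv_apply_up_val_mod_two hn hσ' q'
  apply Fin.ext
  omega

/-- `b(σ)` depends only on the four positions `σ⁻¹(q)`, `q ∈ P`. [folklore] -/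
private theorem bOf_eq_of_inv_apply_eq {σ σ' : Equiv.Perm (Fin (2 * n ^ 2))}
    (h : ∀ q, σ⁻¹ (up (four_le_two_mul_sq hn) q) = σ'⁻¹ (up (four_le_two_mul_sq hn) q)) :
    bOf hn e hN₂ σ = bOf hn e hN₂ σ' := by
  funext q
  unfold bOf
  rw [h]

/-- Realised letters are valid: `b₀ ≠ b₂` (positions `0, 2` share a `T₂`-column). [folklore] -/
private theorem bOf_zero_ne_two {σ : Equiv.Perm (Fin (2 * n ^ 2))} (hσ : σ ∈ (T2 n).colStab) :
    bOf hn e hN₂ σ 0 ≠ bOf hn e hN₂ σ 2 := fun h => by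
  have h' := σ⁻¹.injective (inv_apply_up_eq_of_bOf_eq hn e hN₂ hσ hσ (by decide) h)
  have := congrArg Fin.val h'
  rw [up_val, up_val] at this
  exact absurd this (by decide)

/-- Realised letters are valid: `b₁ ≠ b₃` (positions `1, 3` share a `T₂`-column). [folklore] -/
private theorem bOf_one_ne_three {σ : Equiv.Perm (Fin (2 * n ^ 2))} (hσ : σ ∈ (T2 n).colStab) :
    bOf hn e hN₂ σ 1 ≠ bOf hn e hN₂ σ 3 := fun h => by
  have h' := σ⁻¹.injective (inv_apply_up_eq_of_bOf_eq hn e hN₂ hσ hσ (by decide) h)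
  have := congrArg Fin.val h'
  rw [up_val, up_val] at this
  exact absurd this (by decide)

/-- **Every valid letter assignment at `P` is realised by a column permutation** (two
transpositions per parity class). [folklore] -/
private theorem exists_colStab_bOf_eq (hNn : N = n ^ 2) (b : Fin 4 → Fin n × Fin n) (hb02 : b 0 ≠ b 2)
    (hb13 : b 1 ≠ b 3) : ∃ σ ∈ (T2 n).colStab, bOf hn e hN₂ σ = b := by
  classical
  have h4d : 4 ≤ 2 * n ^ 2 := four_le_two_mul_sq hn
  set u : Fin 4 → Fin (2 * n ^ 2) := up h4d with hu
  have hu_val : ∀ q : Fin 4, (u q).val = q.val := fun q => rfl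
  have hu_inj : ∀ q q' : Fin 4, u q = u q' → q = q' := fun q q' h =>
    Fin.ext (by simpa [hu_val] using congrArg Fin.val h)
  have hrow : ∀ q : Fin 4, (e (b q)).val < n ^ 2 := fun q => by rw [← hNn]; exact (e (b q)).isLt
  set xpos : Fin 4 → Fin (2 * n ^ 2) := fun q => ⟨2 * (e (b q)).val + q.val % 2, by
    have := hrow q; omega⟩ with hx
  have hx_val : ∀ q : Fin 4, (xpos q).val = 2 * (e (b q)).val + q.val % 2 := fun q => rfl
  have hx_par : ∀ q : Fin 4, (xpos q).val % 2 = q.val % 2 := fun q => by rw [hx_val]; omega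
  have hw₂x : ∀ q : Fin 4, (T2 n).rowWord hN₂ (xpos q) = e (b q) := fun q => by
    apply Fin.ext; rw [rowWord_T2_val, hx_val]; omega
  have hx02 : xpos 0 ≠ xpos 2 := by
    intro h
    have h' := congrArg Fin.val h
    rw [hx_val, hx_val] at h'
    have : (e (b 0)).val = (e (b 2)).val := by simp at h'; omega
    exact hb02 (e.injective (Fin.ext this))
  have hx13 : xpos 1 ≠ xpos 3 := by
    intro h
    have h' := congrArg Fin.val h
    rw [hx_val, hx_val] at h'
    have : (e (b 1)).val = (e (b 3)).val := by simp at h'; omega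
    exact hb13 (e.injective (Fin.ext this))
  obtain ⟨ρe, hρe0, hρe2, hρepar, hρefix⟩ := exists_perm_pair (u 0) (u 2) (xpos 0) (xpos 2)
    (fun h => by have := hu_inj _ _ h; exact absurd this (by decide)) hx02
    ⟨by rw [hu_val, hu_val]; decide, by rw [hx_par, hu_val], by rw [hx_par, hu_val]; decide⟩
  obtain ⟨ρo, hρo1, hρo3, hρopar, hρofix⟩ := exists_perm_pair (u 1) (u 3) (xpos 1) (xpos 3)
    (fun h => by have := hu_inj _ _ h; exact absurd this (by decide)) hx13
    ⟨by rw [hu_val, hu_val]; decide, by rw [hx_par, hu_val], by rw [hx_par, hu_val]; decide⟩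
  set ρ := ρo * ρe with hρ
  have hρpar : ∀ q, (ρ q).val % 2 = q.val % 2 := fun q => by
    rw [hρ, Equiv.Perm.mul_apply, hρopar, hρepar]
  have hρu : ∀ q : Fin 4, ρ (u q) = xpos q := by
    intro q
    fin_cases q
    · show ρ (u 0) = xpos 0
      rw [hρ, Equiv.Perm.mul_apply, hρe0, hρofix _ (by rw [hx_par, hu_val]; decide)]
    · show ρ (u 1) = xpos 1
      rw [hρ, Equiv.Perm.mul_apply, hρefix _ (by rw [hu_val, hu_val]; decide), hρo1]
    · show ρ (u 2) = xpos 2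
      rw [hρ, Equiv.Perm.mul_apply, hρe2, hρofix _ (by rw [hx_par, hu_val]; decide)]
    · show ρ (u 3) = xpos 3
      rw [hρ, Equiv.Perm.mul_apply, hρefix _ (by rw [hu_val, hu_val]; decide), hρo3]
  set σ : Equiv.Perm (Fin (2 * n ^ 2)) := ρ⁻¹ with hσdef
  have hσinv : σ⁻¹ = ρ := inv_inv ρ
  have hσ : σ ∈ (T2 n).colStab := by
    refine StdFilling.mem_colStab.2 fun q => ?_
    rw [T2_apply, T2_apply, t2_snd, t2_snd]
    have := hρpar (σ q)
    rw [← hσinv, perm_inv_apply_apply] at this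
    exact this.symm
  refine ⟨σ, hσ, funext fun q => ?_⟩
  unfold bOf
  rw [hσinv, hρu, hw₂x, Equiv.symm_apply_apply]

/-- The fibres of `σ ↦ b(σ)` over realised letters are right translates of one another, hence
of equal size. [folklore] -/
private theorem card_fibre_eq {b : Fin 4 → Fin n × Fin n} {σb : Equiv.Perm (Fin (2 * n ^ 2))}
    (hσb : σb ∈ (T2 n).colStab) (hb : bOf hn e hN₂ σb = b) :
    ((T2 n).colStab.filter fun σ => bOf hn e hN₂ σ = b).card =
      ((T2 n).colStab.filter fun σ => bOf hn e hN₂ σ = bOf hn e hN₂ 1).card := by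
  classical
  refine Finset.card_bij' (fun σ _ => σ * σb⁻¹) (fun ρ _ => ρ * σb) ?_ ?_
    (fun σ _ => inv_mul_cancel_right σ σb) (fun ρ _ => mul_inv_cancel_right ρ σb)
  · intro σ hσ
    rw [Finset.mem_filter] at hσ ⊢
    refine ⟨StdFilling.mul_mem_colStab hσ.1 (StdFilling.inv_mem_colStab hσb),
      bOf_eq_of_inv_apply_eq hn e hN₂ fun q => ?_⟩
    have hq := inv_apply_up_eq_of_bOf_eq hn e hN₂ hσ.1 hσb (q := q) (q' := q) rfl
      (by rw [hσ.2, hb])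
    rw [mul_inv_rev, inv_inv, Equiv.Perm.mul_apply, hq, perm_apply_inv_apply, inv_one,
      Equiv.Perm.one_apply]
  · intro ρ hρ
    rw [Finset.mem_filter] at hρ ⊢
    refine ⟨StdFilling.mul_mem_colStab hρ.1 hσb, ?_⟩
    rw [← hb]
    refine bOf_eq_of_inv_apply_eq hn e hN₂ fun q => ?_
    have hq := inv_apply_up_eq_of_bOf_eq hn e hN₂ hρ.1 (StdFilling.one_mem_colStab _) (q := q)
      (q' := q) rfl (by rw [hρ.2])
    rw [mul_inv_rev, Equiv.Perm.mul_apply, hq, inv_one, Equiv.Perm.one_apply]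

/-- The realised letter assignments are exactly the valid ones. [folklore] -/
private theorem image_bOf_eq (hNn : N = n ^ 2) :
    (T2 n).colStab.image (bOf hn e hN₂) =
      Finset.univ.filter fun b : Fin 4 → Fin n × Fin n => b 0 ≠ b 2 ∧ b 1 ≠ b 3 := by
  classical
  ext b
  simp only [Finset.mem_image, Finset.mem_filter, Finset.mem_univ, true_and]
  constructor
  · rintro ⟨σ, hσ, rfl⟩
    exact ⟨bOf_zero_ne_two hn e hN₂ hσ, bOf_one_ne_three hn e hN₂ hσ⟩
  · rintro ⟨h02, h13⟩
    exact exists_colStab_bOf_eq hn e hN₂ hNn b h02 h13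

/-- **Constant fibres.** `∑_{σ ∈ C_{T₂}} Φ(b(σ)) = c · ∑_{b valid} Φ(b)` with `c ≠ 0` (the common
fibre size). [folklore] -/
private theorem sum_colStab_T2_bOf (hNn : N = n ^ 2) (Φ : (Fin 4 → Fin n × Fin n) → ℂ) :
    ∃ c : ℕ, c ≠ 0 ∧ ∑ σ ∈ (T2 n).colStab, Φ (bOf hn e hN₂ σ) =
      c • ∑ b ∈ Finset.univ.filter (fun b : Fin 4 → Fin n × Fin n => b 0 ≠ b 2 ∧ b 1 ≠ b 3),
        Φ b := by
  classical
  refine ⟨((T2 n).colStab.filter fun σ => bOf hn e hN₂ σ = bOf hn e hN₂ 1).card, ?_, ?_⟩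
  · exact Finset.card_ne_zero.2 ⟨1, Finset.mem_filter.2 ⟨StdFilling.one_mem_colStab _, rfl⟩⟩
  · rw [Finset.sum_comp Φ (bOf hn e hN₂), Finset.smul_sum, image_bOf_eq hn e hN₂ hNn]
    refine Finset.sum_congr rfl fun b hb => ?_
    rw [← image_bOf_eq hn e hN₂ hNn, Finset.mem_image] at hb
    obtain ⟨σb, hσb, hσbb⟩ := hb
    rw [card_fibre_eq hn e hN₂ hσb hσbb]

end Fibres

/-! ## §14 The case `n = 2`: the signed count is `−48 · c ≠ 0` -/

section Two

/-- **The finite core for `n = 2`** (rows `(0,1),(1,0),(0,0)` of `A`): summed over the valid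
letter assignments `b : P → [2]²` (`b₀ ≠ b₂`, `b₁ ≠ b₃`), the signed core sums `Φ(b)` total
`−48`. Checked by the kernel (`decide`). [folklore] -/
private theorem core_two_Phi :
    (∑ b ∈ Finset.univ.filter (fun b : Fin 4 → Fin 2 × Fin 2 => b 0 ≠ b 2 ∧ b 1 ≠ b 3),
      Phi false b) = -48 := by
  decide +kernel

/-- **The pairing does not vanish for `n = 2`** (switch `three = false`): it equals `−48·c` with
`c ≠ 0` the common fibre size. [cite: BurgisserIkenmeyer2011, Lemma 6.1] -/
theorem pairing_ne_zero_two {N : ℕ} (hn : 2 ≤ 2) (e : Fin 2 × Fin 2 ≃ Fin N)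
    (hN₁ : ∀ x ∈ (bi2011Last 2 hn).youngDiagram.cells, x.1 < N)
    (hN₂ : ∀ x ∈ (bi2011TwoRect 2).youngDiagram.cells, x.1 < N) (hNn : N = 2 ^ 2) :
    ∑ u, ∑ v, ∑ w, kroneckerPow (actTensor (Amat e false) 1 (Cmat e) (matMulRelabel 2 N e))
        (2 * 2 ^ 2) u v w *
        triad ((T1 2 hn).polytabloid ℂ hN₁) ((T2 2).polytabloid ℂ hN₂) ((T3 2 hn).polytabloid ℂ hN₂)
          u v w ≠ 0 := by
  classical
  rw [pairing_eq_tripleSum (n := 2) hn e false hN₁ hN₂]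
  rw [Finset.sum_congr rfl fun π hπ => Finset.sum_congr rfl fun σ hσ =>
    sum_tau_eq_sum_kap (n := 2) hn e false hN₁ hN₂ hπ hσ]
  rw [Finset.sum_comm]
  rw [Finset.sum_congr rfl fun σ _ => inner_eq_Phi (n := 2) hn e false hN₁ hN₂ σ]
  obtain ⟨c, hc, hsum⟩ :=
    sum_colStab_T2_bOf (n := 2) hn e hN₂ hNn (fun b => ((Phi false b : ℤ) : ℂ))
  rw [hsum, ← Int.cast_sum, core_two_Phi, nsmul_eq_mul]
  push_cast
  exact mul_ne_zero (Nat.cast_ne_zero.2 hc) (by norm_num)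

/-- **Occurrence of `λ₂ = ((5,1,1,1), 2⁴, 2⁴)` in degree `8` for `⟨2,2,2⟩`** (the case `n = 2` of
BI's Lemma 6.1, occurrence half). [cite: BurgisserIkenmeyer2011, Lemma 6.1] -/
theorem isotypicSum_ne_zero_two (hn : 2 ≤ 2) :
    isotypicSum₁ (bi2011Last 2 hn) (isotypicSum₂ (bi2011TwoRect 2) (isotypicSum₃ (bi2011TwoRect 2)
      (kroneckerPow (matMulTensor ℂ 2 2 2) (2 * 2 ^ 2)))) ≠ 0 := by
  classical
  set N := Fintype.card (Fin 2 × Fin 2) with hNdef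
  have hNn : N = 2 ^ 2 := by rw [hNdef, Fintype.card_prod, Fintype.card_fin, sq]
  set e : Fin 2 × Fin 2 ≃ Fin N := Fintype.equivFin (Fin 2 × Fin 2)
  have h4 : 4 ≤ 2 ^ 2 := by norm_num
  have hN₁ : ∀ x ∈ (bi2011Last 2 hn).youngDiagram.cells, x.1 < N := fun x hx => by
    rcases mem_youngDiagram_bi2011Last.1 ((YoungDiagram.mem_cells _).1 hx) with ⟨h0, -⟩ | ⟨-, h4', -⟩
      <;> omega
  have hN₂ : ∀ x ∈ (bi2011TwoRect 2).youngDiagram.cells, x.1 < N := fun x hx => by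
    have := (mem_youngDiagram_bi2011TwoRect.1 ((YoungDiagram.mem_cells _).1 hx)).1
    omega
  set lam : Fin 3 → Nat.Partition (2 * 2 ^ 2) := ![bi2011Last 2 hn, bi2011TwoRect 2, bi2011TwoRect 2]
    with hlam
  have hl0 : lam 0 = bi2011Last 2 hn := rfl
  have hl1 : lam 1 = bi2011TwoRect 2 := rfl
  have hl2 : lam 2 = bi2011TwoRect 2 := rfl
  have key := isotypicSum₁₂₃_kroneckerPow_ne_zero_relabel_iff (matMulTensor ℂ 2 2 2) e e e lam
  rw [hl0, hl1, hl2] at key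
  rw [← key]
  have hd₁ : (bi2011Last 2 hn).youngDiagram.cells.card = 2 * 2 ^ 2 :=
    Nat.Partition.card_cells_youngDiagram _
  have hd₂ : (bi2011TwoRect 2).youngDiagram.cells.card = 2 * 2 ^ 2 :=
    Nat.Partition.card_cells_youngDiagram _
  have h₁ := StdFilling.polytabloid_mem (k := ℂ) hN₁ (T1 2 hn) hd₁
  have h₂ := StdFilling.polytabloid_mem (k := ℂ) hN₂ (T2 2) hd₂
  have h₃ := StdFilling.polytabloid_mem (k := ℂ) hN₂ (T3 2 hn) hd₂
  rw [ydWeight_youngDiagram] at h₁ h₂ h₃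
  exact isotypicSum₁₂₃_kroneckerPow_ne_zero_of_pairing_ne_zero (lam := lam) h₁ h₂ h₃ (Amat e false) 1
    (Cmat e) (matMulRelabel 2 N e) (pairing_ne_zero_two hn e hN₁ hN₂ hNn)

end Two

end BI2011Occurrence

/-! ## §15 The headline for all `n ≥ 2` and the discharge of the named fact -/

/-- **Bürgisser–Ikenmeyer 2011, Lemma 6.1 — the occurrence half, for every `n ≥ 2`:** the type
`λₙ = ((2n²−3,1,1,1), 2^{n²}, 2^{n²})` occurs in degree `2n²` of `𝒪(\overline{GL³·⟨n,n,n⟩})`,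
i.e. the triple isotypic character sum of type `λₙ` does not kill `⟨n,n,n⟩^{⊗2n²}` — exactly the
hypothesis `hocc` of the tree's `burgisserIkenmeyer2011_lemma_6_1_of_occurrence`. Printed with
the proof omitted ("guided by computer calculations", §6.1; §10.18); proved here by the
degenerate evaluation of the module docstring (`n ≥ 3`: every non-zero term is `−1`; `n = 2`: the
signed count is `−48·c`). [cite: BurgisserIkenmeyer2011, Lemma 6.1] -/
theorem isotypicSum_bi2011_kroneckerPow_matMulTensor_ne_zero (n : ℕ) (hn : 2 ≤ n) :
    isotypicSum₁ (bi2011Last n hn) (isotypicSum₂ (bi2011TwoRect n) (isotypicSum₃ (bi2011TwoRect n)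
      (kroneckerPow (matMulTensor ℂ n n n) (2 * n ^ 2)))) ≠ 0 := by
  by_cases h3 : 3 ≤ n
  · exact BI2011Occurrence.isotypicSum_ne_zero_of_three_le n hn h3
  · obtain rfl : n = 2 := by omega
    exact BI2011Occurrence.isotypicSum_ne_zero_two hn

/-- **Discharge of the named fact `burgisserIkenmeyer2011_lemma_6_1`** (BI 2011, Lemma 6.1:
`λₙ ∈ S(⟨n,n,n⟩) ∖ S°(⟨n²+1⟩)` for `n ≥ 2`): the unit-tensor half is the tree's
`isotypicSum_bi2011_kroneckerPow_unitTensor_eq_zero`, the occurrence half is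
`isotypicSum_bi2011_kroneckerPow_matMulTensor_ne_zero`. [cite: BurgisserIkenmeyer2011, Lemma 6.1] -/
theorem burgisserIkenmeyer2011_lemma_6_1_holds : burgisserIkenmeyer2011_lemma_6_1 :=
  burgisserIkenmeyer2011_lemma_6_1_of_occurrence isotypicSum_bi2011_kroneckerPow_matMulTensor_ne_zero

end Literature.Computability.AlgebraicComplexity
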